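import Mathlib
import HarnessLib
import HarnessLib.Audit
import Summits.CriticalPhenomena.Statement
import Literature.Probability.LatticeModels.MedialWinding
import Literature.Probability.RandomPlanarGeometry.SLE
import Summits.CriticalPhenomena.CardyFormulaZ2.Theorems.CardySusyWardDiscretisationFamilyExists
import HarnessLib.Audit.Status.Attr

/-!
Route: CardyComplexCone

DORMANT since 2026-08-26T16:12:37Z (reconciler: no traction for 6.2 d (last activity item-proof-filed at 2026-08-20T11:59:15Z); parked, not closed — `ledger route dormant route-CriticalPhenomena-CardyComplexCone --off` to reactivate) — unstaffed, not closed; items shared with open routes are served there. `ledger route dormant <id> --off` reactivates.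

# Route CardyComplexCone — complex Perron–Frobenius for percolation — Rugh–Dubois cone contraction
of the winding-twisted two-arm kernel gives sublattice coherence of the q=1 parafermion, the missing
half of CR on Z2

It suffices to show X = EdgeCoherence ∧ EdgePrecompact for the sublattice-resolved q = 1, spin-1/3
parafermionic EDGE observable of
bond percolation on δℤ² at p = 1/2, E_δ(v,f) := E[ Σ over passages of the Dobrushin exploration
interface γ = medialExploration (Λ δ) (the definiens of the abbrev fkInterface; rev 3 states every
item over the
fact-free modules MedialWinding / MedialInterface / PolylineWinding instead of FermionicObservable),
Λ any discretisation family
of the Dobrushin domain D (rev 2, FAMILY FORM: (Λ δ).Ω = Ω, mesh δ, ℤ²-admissible data for all small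
δ > 0, arbitrary admissible arcs),
along the oriented medial edge (corner) (v,f) of exp(−(i/3)·W) ], W the winding of the direction of
that edge measured from the start of γ
(library `winding` of the polyline prefix), the four travel classes of corners being indexed by the
offset f − v ∈ {0,−e₀,−e₁,−e₀−e₁}.
EdgeCoherence (realises card complex-cone-winding-perron-frobenius, whose conclusion it is, = K1
"COHERENCE" of the companion card
halfcr-coherence-threshold-one-twelfth): there is ONE universal non-zero class vector u such that
around every interior primal vertex v
the four corner values are projectively aligned with u at leading order, ‖u(f′−v)·E_δ(v,f) −
u(f−v)·E_δ(v,f′)‖ ≤ ε δ^{1/3} eventually,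
uniformly on compacts, in every Dobrushin domain and for every such family Λ (the rev-0/1 canonical
data dobrushinData D δ behind the guard
`∀ᶠ δ, IsZdAdmissible` are inadmissible at every mesh on the unit disc and along δ_k → 0⁺ on every
axis-aligned rectangle —
CanonicalDiscretisationTies.lean, InterfaceScalingLimitDiscretised.lean §2 — so the guarded
statements were generically vacuous; rev 2 quantifies
over families instead, as the printed sources do). EdgePrecompact: δ^{−1/3}E_δ is
locally bounded and class-wise equicontinuous. The card's mechanism is the intended proof of
EdgeCoherence: a Markov block presentation of
(two-arm event, ω^{N}) over collar patterns (MarkovBlockPresentation) in which the winding-twisted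
block kernel a_b(ξ,η) = E[ω^{N_b}·1_η | ξ]
satisfies Dubois' four-pattern inequality with uniform (θ,σ) at one block ratio b
(UniformConeCondition); Dubois' contraction principle
(support ComplexConeContraction, typed and provable now) then contracts the projective distance by
tanh(Δ/4) per block, Δ ≤ 8 log((1+θ)/(1−θ))
+ 2 log σ, and the contracted direction read on the four corner test functions is u.
Lean: `(∃ u : Literature.Probability.LatticeModels.Site 2 → ℂ, (∃ o :
Literature.Probability.LatticeModels.Site 2, Literature.Probability.LatticeModels.IsCorner 0 o ∧ u o
≠ 0) ∧ ∀ (D : Literature.Probability.RandomPlanarGeometry.DobrushinDomain) (Λ : ℝ →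
Literature.Probability.LatticeModels.DiscreteDobrushin), (∀ δ, (Λ δ).Ω = D.carrier) → (∀ δ, (Λ δ).δ
= δ) → (∀ᶠ δ in nhdsWithin (0:ℝ) (Set.Ioi 0), (Λ δ).IsZdAdmissible) → let E : ℝ →
Literature.Probability.LatticeModels.Site 2 → Literature.Probability.LatticeModels.Site 2 → ℂ := fun
δ v f => ∫ ω, (let γ := Literature.Probability.LatticeModels.medialExploration (Λ δ) ω; ∑ k ∈
(Finset.range γ.length).filter (fun k => γ[k]? = some
(Literature.Probability.LatticeModels.cornerSource v f) ∧ γ[k + 1]? = some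
(Literature.Probability.LatticeModels.cornerTarget v f)), Complex.exp (-(Complex.I / 3) *
((Literature.Probability.LatticeModels.winding ((γ.map
(Literature.Probability.LatticeModels.medialPoint δ)).take (k + 2)) : ℝ) : ℂ)))
∂(Literature.Probability.Percolation.bondPercolation (Literature.Probability.LatticeModels.zdGraph
2) Literature.Probability.Percolation.half); ∀ K : Set ℂ, IsCompact K → K ⊆ D.carrier → ∀ ε > (0:ℝ),
∀ᶠ δ in nhdsWithin (0:ℝ) (Set.Ioi 0), ∀ v f f' : Literature.Probability.LatticeModels.Site 2,
Literature.Probability.LatticeModels.IsCorner v f → Literature.Probability.LatticeModels.IsCorner v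
f' → Literature.Probability.LatticeModels.meshPoint δ v ∈ K → ‖u (f' - v) * E δ v f - u (f - v) * E
δ v f'‖ ≤ ε * δ ^ ((1:ℝ) / 3)) ∧ (∀ (D :
Literature.Probability.RandomPlanarGeometry.DobrushinDomain) (Λ : ℝ →
Literature.Probability.LatticeModels.DiscreteDobrushin), (∀ δ, (Λ δ).Ω = D.carrier) → (∀ δ, (Λ δ).δ
= δ) → (∀ᶠ δ in nhdsWithin (0:ℝ) (Set.Ioi 0), (Λ δ).IsZdAdmissible) → let E : ℝ →
Literature.Probability.LatticeModels.Site 2 → Literature.Probability.LatticeModels.Site 2 → ℂ := fun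
δ v f => ∫ ω, (let γ := Literature.Probability.LatticeModels.medialExploration (Λ δ) ω; ∑ k ∈
(Finset.range γ.length).filter (fun k => γ[k]? = some
(Literature.Probability.LatticeModels.cornerSource v f) ∧ γ[k + 1]? = some
(Literature.Probability.LatticeModels.cornerTarget v f)), Complex.exp (-(Complex.I / 3) *
((Literature.Probability.LatticeModels.winding ((γ.map
(Literature.Probability.LatticeModels.medialPoint δ)).take (k + 2)) : ℝ) : ℂ)))
∂(Literature.Probability.Percolation.bondPercolation (Literature.Probability.LatticeModels.zdGraph
2) Literature.Probability.Percolation.half); ∀ K : Set ℂ, IsCompact K → K ⊆ D.carrier → (∃ C : ℝ, ∀ᶠ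
δ in nhdsWithin (0:ℝ) (Set.Ioi 0), ∀ v f : Literature.Probability.LatticeModels.Site 2,
Literature.Probability.LatticeModels.IsCorner v f → Literature.Probability.LatticeModels.meshPoint δ
v ∈ K → ‖E δ v f‖ ≤ C * δ ^ ((1:ℝ) / 3)) ∧ (∀ ε > (0:ℝ), ∃ η > (0:ℝ), ∀ᶠ δ in nhdsWithin (0:ℝ)
(Set.Ioi 0), ∀ v f v' f' : Literature.Probability.LatticeModels.Site 2,
Literature.Probability.LatticeModels.IsCorner v f → Literature.Probability.LatticeModels.IsCorner v'
f' → f - v = f' - v' → Literature.Probability.LatticeModels.meshPoint δ v ∈ K →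
Literature.Probability.LatticeModels.meshPoint δ v' ∈ K → dist
(Literature.Probability.LatticeModels.meshPoint δ v) (Literature.Probability.LatticeModels.meshPoint
δ v') < η → ‖E δ v f - E δ v' f'‖ ≤ ε * δ ^ ((1:ℝ) / 3)))`

## Assembly
Pure logic (modus ponens; deciding theorem `closes : EdgeCoherence → EdgePrecompact → CoherentMorera
→ ParafermionToSLESixFamilies →
SLESixFamiliesGiveCardy → CardyFormulaZ2`, sorry-free in the planner's Sketch.lean, axioms propext /
Classical.choice / Quot.sound):
CoherentMorera turns EdgeCoherence + EdgePrecompact into the family forms of WeakHolomorphy ∧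
ParafermionPrecompact, ParafermionToSLESixFamilies
turns those two into SLE₆ for every Dobrushin domain and every discretisation family (=
SLE6LimitZ2AllDiscretisations, spelled inline as the
antecedent of SLESixFamiliesGiveCardy, so that no open named fact enters the dependency cone) and
SLESixFamiliesGiveCardy gives the conjunct
(rev 2: the canonical-data items ParafermionToSLESix → SLE6LimitZ2 and SLESixGivesCardy :
SLE6LimitZ2 → CardyFormulaZ2 are dropped from this route). Rev 3: the two vertex-observable clauses
of
CoherentMorera's conclusion and of ParafermionToSLESixFamilies' second hypothesis carry the
lattice-edge guards z, z′ ∈ (zdGraph 2).edgeSet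
(refuter repair C′: MedialVertex = Sym2 (Site 2) contains non-edge pairs sharing a medial point with
an edge, where F_δ ≡ 0, so the unguarded
equicontinuity clause forced δ^{−1/3}F_δ → 0 — evidence Evidence.lean / EvidenceCM.lean /
Degeneration.lean / Repair.lean on stmt-11266, stmt-11268);
both sides change identically, so `closes` is unchanged. The cone mechanism (UniformConeCondition,
MarkovBlockPresentation, filed informally after open, + the typed engine ComplexConeContraction) is
the intended proof of EdgeCoherence and
does not enter the formal assembly.

Rationale: WHY THIS LINE. The q = 1 parafermion of bond-ℤ² obeys only the vertex half of discrete
Cauchy–Riemann (DuminilCopinSmirnov2012Lattice Prop. 8.6,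
DuminilCopin2012Parafermion Prop. 4; barrier FKParafermionicHalfCauchyRiemann), and the companion
card halfcr-coherence-threshold-one-twelfth
reduces the missing dual half, modulo precompactness, to LEADING-ORDER SUBLATTICE COHERENCE — a
rank-one (projective) statement about the
ℤ₃-winding-twisted two-arm scale chain — while showing that configuration couplings can certify it
only past the exponent threshold 1/12,
no Perron–Frobenius theorem being available for a complex kernel. This line imports one from smooth
dynamics / thermodynamic formalism:
Birkhoff's projective-metric contraction (Birkhoff1957) in the COMPLEX cones of Rugh2010 and
Dubois2009 (arXiv:0811.2930 Thm 1.1, Prop 3.3,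
Thm 2.3, Thm 3.6), used for sequential / random compositions of complex transfer operators in
HafoutaKifer2017 and DemersLiverani2025, with
the explicit dictionary positive Kesten kernel ↦ |a_b| (quasi-multiplicativity with arbitrary
landing data, Kesten1987Scaling, Nolin2008 =
finiteness of the real cross-ratio σ), conditional mean winding phase ↦ arg a_b, Dubois' 2×2
criterion ↦ a four-pattern "winding-interaction
aperture" inequality, Perron direction ↦ the universal class vector u; at spin 1/3 the separable
part of the block phase is free
(cos(Δα/3)cos(Δβ/3) > 0 tolerates phase ranges up to 3π/2), so only interaction windings and the
deviation of |a_b| from rank one are charged,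
and the hypotheses are UNIFORM O(1) INEQUALITIES AT ONE SCALE RATIO, not rates. No prior route of
the conjunct uses cones or projective metrics
(CardySectorGap: positive annulus operator + Doeblin/sector gaps > 3/4; CardySusyWard: an exact SUSY
identity for the same dual half;
curl-defect-mixing-rate card: a local-law rate); the downstream items are in FAMILY FORM (rev 2):
ParafermionToSLESixFamilies concludes SLE₆ for all discretisation families inline and
SLESixFamiliesGiveCardy (shared with CardySusyWard, whose pending family-form repair can attach to
the former verbatim) gives Cardy, so that
no open named fact (SLE6LimitZ2) is assumed or even named; the negatives index (SAW tightness
0772/8261/8312, PercQuarantine 7073, DualCurrentTemplate 6949) is untouched — every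
statement quantifies over families ℤ²-admissible for all small δ and concludes along `𝓝[>] 0`, as
the 0772 lesson requires. Rev 6 (route-repair 2026-08-17, badge skeleton.hides-summit on #5): the
deciding theorem is re-wired through the strategists' SUMMIT CUT — closes : EdgeCoherence →
EdgePrecompact → UniformInnerEnvelope → DiagBoundaryArmLower → SharpInputsGiveDiagSLESix →
DiagSLESixGivesCardy → CardyFormulaZ2 — so that no load-bearing item concludes SLE₆ for ALL Jordan
domains (block C, kernel-certified beyond the summit: C ↔ S ∧ (S → C) given X,
Theorems/CardyComplexConeParafermionToSLESixFamiliesSummitStrength.lean); #5 stays in the file, off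
the critical path.

RANKED CRUXES. #0 Target (target) — X = EdgeCoherence ∧ EdgePrecompact (both conjuncts spelled out
in their own blocks below; rev 2 family form). (why it might fail: EdgeCoherence is DCS Conjecture
8.7 read projectively class by class; a universal direction may fail to exist (wandering sublattice
phases) or only a degenerate one may, and δ^{1/3} may be the wrong envelope for a signed edge
observable.) [DuminilCopinSmirnov2012Lattice, DuminilCopin2012Parafermion, Dubois2009, Rugh2010]
#2 EdgeCoherence (crux) — a universal class vector u : (offsets) → ℂ, non-zero on at least one of
the four corner classes {0,−e₀,−e₁,−e₀−e₁}, such that for every Dobrushin domain D, every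
discretisation family Λ of D ((Λ δ).Ω = D, mesh δ, ℤ²-admissible for all small δ; arbitrary
admissible arcs), every compact K ⊂ D and ε > 0, eventually in δ: ‖u(f′−v)·E_δ(v,f) −
u(f−v)·E_δ(v,f′)‖ ≤ ε·δ^{1/3} at every primal vertex v with δv ∈ K, E_δ the spin-1/3 corner
observable of γ = medialExploration (Λ δ) (= fkInterface unfolded) under P_{1/2} (card: COHERENCE =
projective convergence of the χ-block, the output of the cone contraction). [difficulty:
open-problem] (why it might fail: rank-one asymptotics of a twisted (non-positive) scale chain can
fail if the two-arm chain mixes slower than 2^{−1/12} per scale in every usable sense; then the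
class phases wander with (Ω, z, δ) and no universal u exists — this also sinks DCS Conj. 8.7.)
[DuminilCopinSmirnov2012Lattice, DuminilCopin2012Parafermion, Dubois2009, Kesten1987Scaling,
GarbanPeteSchramm2013, Zhou2024SLE6BondZ2]
#3 EdgePrecompact (crux) — For every such D, Λ and compact K ⊂ D: (i) ∃ C, eventually in δ,
‖E_δ(v,f)‖ ≤ C·δ^{1/3} for every corner (v,f) with δv ∈ K; (ii) ∀ ε > 0 ∃ η > 0, eventually in δ,
‖E_δ(v,f) − E_δ(v′,f′)‖ ≤ ε·δ^{1/3} for corners of the SAME class (f − v = f′ − v′) with δv, δv′ ∈ K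
at distance < η — δ^{−1/3}E_δ is precompact class by class (the edge form of CardySusyWard's
ParafermionPrecompact, which it yields inside CoherentMorera). [difficulty: XL] (why it might fail:
‖E_δ‖ ≤ P(edge ∈ γ) ≍ δ^{1/4} ≫ δ^{1/3}: the bound needs winding-phase cancellation of order
δ^{1/12} uniformly up to mesoscopic distance from ∂K, with no s-holomorphic primitive (the q = 2
tool); a staggered lattice-scale component would break (ii).) [DuminilCopinSmirnov2012Lattice,
Smirnov2010, Zhou2024SLE6BondZ2, SchrammSteif2010]
#4 CoherentMorera (crux, PROVED — Theorems/CardyComplexConeCoherentMorera.lean +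
Kirchhoff/TraceIdentity/ModeSelection files) — EdgeCoherence → EdgePrecompact →
(WeakHolomorphyFamilies ∧ ParafermionPrecompactFamilies) for the spin-1/3 vertex observable,
lattice-edge guarded (rev 3): 'Morera with sublattices' — the pathwise identity F_δ(z) =
(2cos(π/12))⁻¹ Σ_{c∼z} E_δ(c), class limits f_o = u(o)·f, exact closedness of the edge form + ℤ₄
covariance force u to be a character, χ = 1 gives Morera. [DuminilCopin2012Parafermion,
DuminilCopinSmirnov2012Lattice,
lean:Literature.Barriers.CriticalPhenomena.FKParafermionicHalfCauchyRiemann]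
#5 ParafermionToSLESixFamilies (crux, OFF THE CRITICAL PATH since rev 6 — not a binder of closes;
summit-strength given the thesis: stub slesixAllFamilies_iff / crux_iff_blockC_of_thesis; decl kept
because landed Theorems import it by name; superseded by #8 + #9) — WeakHolomorphyFamilies →
ParafermionPrecompactFamilies → (SLE₆ for every Dobrushin domain and every discretisation family =
SLE6LimitZ2AllDiscretisations inline). [deps: CoherentMorera] [difficulty: XL] (why it might fail:
interior inputs do not exclude the ZERO limit δ^{-1/3}F_δ ⇀ 0; and its conclusion for rough Jordan
domains needs the Camia–Newman lift S → C, which is beyond the summit.)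
[DuminilCopinSmirnov2012Lattice, KemppainenSmirnov2017, DuminilCopin2012Parafermion,
lean:Literature.Probability.Percolation.SLE6LimitZ2AllDiscretisations]
#6 SLESixFamiliesGiveCardy (crux, shared with CardySusyWard, PROVED —
Theorems/CardyComplexConeSLESixFamiliesGiveCardy.lean, cardy_of_statements with stubs A–G) — (SLE₆
for every Dobrushin domain and every discretisation family) → CardyFormulaZ2 by the collar-touch
sandwich: designer Dobrushin domains, free crossing ↔ hitting event up to boundary arm events, a.s.
continuity of hitsBefore, LSW hitting law = Cardy (sle_six_measureReal_hitsBefore). Off the critical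
path since rev 6; its machinery is PIECE 1 of #9. [CamiaNewman2007, Smirnov2001,
LawlerSchrammWerner2001]
#7 DiagBoundaryArmLower (crux, input N of the summit cut) — ∃ c > 0, for all large n: P_{1/2}[0 ↔
far-or-lateral side inside the diagonal half-plane box of size n] ≥ c·n^{−1/3} (verbatim
FlipInvolutionReturnLaw.DiagHalfPlaneOneArmLower; CONDITIONALLY proved from
IkhlefPonsaingFirstPassage, diagArmLower_of_ikhlefPonsaing p119507). [difficulty: open-problem] (why
it might fail: the sharp boundary exponent 1/3 WITH CONSTANTS is open on bond-ℤ² even as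
n^{−1/3+o(1)}; a log-correction or shape-dependent c kills it as typed.) [IkhlefPonsaing2012,
arXiv:2205.15901, arXiv:1108.2784, Zhou2024SLE6BondZ2]
#7 UniformInnerEnvelope (crux, 11387's milestone X1) — ONE C with ‖E_δ(v,f)‖ ≤ C·R^{−1/3} for every
Jordan Dobrushin domain, every ℤ²-admissible discretisation (any mesh, any admissible arcs) and
every corner at lattice depth R ≥ 1: the boundary-uniform form of EdgePrecompact (i) (line
Cruxes/EdgePrecompact/Lines/qkz-strip-boundary-arm). [difficulty: XL] (why it might fail: a priori
‖E_δ‖ ≍ R^{−1/4}; the R^{−1/12} winding cancellation must hold uniformly up to rough arcs / prime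
ends, where no strip comparison exists.) [DuminilCopinSmirnov2012Lattice, Smirnov2010,
IkhlefPonsaing2012]
#8 SharpInputsGiveDiagSLESix (crux, THE CORRECTED #5) — DiagBoundaryArmLower → UniformInnerEnvelope
→ EdgeCoherence → EdgePrecompact → SLE₆ for the medial exploration of every discretisation family of
every Dobrushin domain whose frontier is a finite union of slope-±1 segments (Ωδ / curve / measure
verbatim as in #5–#6); = line potential-darboux-picard-diamond cut at the curve law on diagonal
polygons: S1/S2/S4′ and potentialConformalLimit_of_inputs LANDED (p162308, p151443, p169165), open =
S5 pin uniformity + S6 KS transport ⇐ PercFaceBoxTight (plan sharpInputsGiveDiagSLESix_of_diamond,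
Cruxes/ParafermionToSLESixFamilies/BridgeR1.lean). Not ≥ S: the diagonal-polygon curve law does not
follow from crossing limits without Camia–Newman; bridge split T ∧ (T → ·) with T = the four open
inputs, all binders. [deps: the four inputs] [difficulty: XL] (why it might fail: pin/slit
uniformity of the identified potential's touch law and KS crossing bounds for the SELF-TOUCHING
medial polyline can each fail with all inputs true.) [KemppainenSmirnov2017,
DuminilCopinSmirnov2012Lattice, DuminilCopin2012Parafermion, CamiaNewman2007, arXiv:1004.4673,
Zhou2024SLE6BondZ2]
#9 DiagSLESixGivesCardy (support, closable now) — (conclusion of #8) → CardyFormulaZ2: PIECE 1 =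
#6's collar-touch sandwich (cardy_of_statements, stubs A–G landed) re-run at all-diagonal designer
domains with diagonal-staircase collars (new STUB E only) + PIECE 2 = cardyFormulaZ2_of_diagCardy
(PROVED p134764, diagonal Bollobás–Riordan sandwich); plan diagSLESixGivesCardy_of_piece1
(BridgeR1.lean). S → #9 trivially (informational), used toward S only through #8. [difficulty: L]
[CamiaNewman2007, Smirnov2001, BollobasRiordan2006]
#9 ComplexConeContraction (support, PROVED — Theorems/CardyComplexConeComplexConeContraction*.lean)
— THE ENGINE: sequential products of complex matrices satisfying Dubois' 2×2 aperture inequality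
with uniform (θ, σ) contract Rugh's cone ℂ₊ⁿ projectively at rate tanh(Δ/4), Δ = 8 log((1+θ)/(1−θ))
+ 2 log σ. [Dubois2009, Rugh2010, Birkhoff1957]
#9 DiscretisationFamilyExists (support, PROVED) — every Dobrushin domain admits a discretisation
family (the six ZdDiscretisationFamily fields, unbundled): the family-form items are not vacuous.
[CDHKSCRAS2014, Smirnov2007ICM]
#9 AEMeasurableInterfaceIn (support, PROVED — Theorems/CardyComplexConeAEMeasurableInterfaceIn.lean)
— a.e.-measurability under P_{1/2} of the endpoint-oriented medial exploration curve class at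
positive mesh (the measurability clause of ConvergesInLawToSLE). [AizenmanBurchard1999, Smirnov2001]

TWO-LAYER PLAN. Foreseen glued splits (none filed now; k ≤ 3, depth 1): EdgeCoherence ⇐
MarkovBlockPresentation → UniformConeCondition → EdgeCoherence (informal stmt-8879/8880 DROPPED
untyped at rev 6 — prover verdicts misstated 2026-08-16; part (ii) contraction ⇒ coherence landed
p84227/p84770/p85802; re-file TYPED as these children)
(glue = ComplexConeContraction iterated over the ⌊log_b(dist(z,∂D)/δ)⌋ blocks around z, leakage off
the good sub-cone as a perturbation of a
gapped chain, and reading the contracted direction on the four corner test functions);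
CoherentMorera ⇐ CharacterSelection (u is the
conformal character, even part non-degenerate) → SublatticeMorera (companion F2 with the tree's
conventions) → CoherentMorera;
EdgePrecompact ⇐ BulkThirdMomentBound → ClasswiseEquicontinuity → EdgePrecompact;
SharpInputsGiveDiagSLESix ⇐ PinUniformity (S5: pin/slit-uniform touch law of the identified
potential) → IdentOnDiagRectilinear (S6 ⇐ PercFaceBoxTight: KS transport,
identOnDiagRectilinear_of_boxTight_of_paraApprox p138957) → SharpInputsGiveDiagSLESix (glue
slesixAlong_of_ident + potentialConformalLimit_of_inputs, landed); DiagSLESixGivesCardy ⇐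
DiagCollarDomains (STUB E with staircase collars) → DiagSLESixGivesCardy. EdgePrecompact may be
partly unnecessary on #8's line (closedClass_continuous_of_edgeCoherence uses EdgeCoherence alone) —
a tenure decision, not acted on here.

KILL CRITERIA. (1) The Monte-Carlo four-pattern test (Cheapest falsifier) failing for TYPICAL
pattern pairs at every block ratio b ∈ {4, 8, 16} kills the
mechanism: close `refuted:UniformConeCondition` (with the evidence file) unless a restriction to a
good sub-cone carrying all but e^{−c(b)}
of the two-arm mass passes the same test with leakage < 1 − tanh(Δ/4) — then restate once, not
twice. (2) A transfer-matrix or Monte-Carlo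
measurement showing the four corner classes of E_δ at a bulk point NOT settling to one projective
direction as δ ↓ 0 refutes EdgeCoherence
and with it DCS Conj. 8.7 by this road: close `refuted:EdgeCoherence` and hand the witness to the
barrier catalogue. (3) ¬CoherentMorera
because the universal u is the anti-conformal real character is a convention artefact (spin 1/3 ↔
−1/3, shared with CardySusyWard's
WeakHolomorphy): restate both, do not close; u = ±i-character or degenerate even part: close (Morera
yields nothing). (4) ¬EdgePrecompact with
EdgeCoherence alive: pivot to the δ^{−1/4}-normalised or phase-stripped edge observable. (5)
WeakHolomorphy or SLE₆ on ℤ² in family form (SLE6LimitZ2AllDiscretisations) proved elsewhere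
(CardySusyWard, CardyViaSLE6, CardyRotToConf, CardySelfRefinement) moots #4, #5, #8, #9 but not
EdgeCoherence / EdgePrecompact / UniformInnerEnvelope / DiagBoundaryArmLower, which stay as theorem
targets about ℤ² percolation. (6) A refutation of ComplexConeContraction can only be a misstatement
of Dubois' theorem: restate from the paper. (7) EXECUTED at rev 6: #5 is one-sided and, given the
thesis, summit-strength (skeleton.hides-summit; SummitStrength.lean), so the corrected crux #8
SharpInputsGiveDiagSLESix with the explicit inputs N = DiagBoundaryArmLower and U-envelope =
UniformInnerEnvelope replaces it on the critical path; a future line on #8 whose stub alone implies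
its conclusion is the same defect again — re-skeleton, do not restate. (8) ¬DiagBoundaryArmLower by
a log-correction or c → 0: restate N in the n^{−1/3−o(1)} / IP-strip form the line actually consumes
(freeTouchLower_of_diagArmLower) and re-prove S3′; ¬UniformInnerEnvelope at rough arcs with the
compact form alive: restrict #8 to discretisations with admissible STAIRCASE arcs (all the diagonal
cut needs). (1′) STATUS of (1): prover evidence on stmt-8879 (v3, 2026-08-16, L = 512 preview, 9470
hulls): the LOCAL block-winding reading of a_b fails Dubois' inequality at every b ∈ {2..32}; larger
boxes / non-local readings / the good-sub-cone restriction untested — the tenure planner's call;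
EdgeCoherence itself is not refuted by it.

NOT DECOMPOSED YET. The interior of the mechanism — the exact pattern space (full collar
configurations with crossing data vs. binned sectors × arm topology),
the good/bad pattern split and its leakage bookkeeping, the complex quasi-multiplicativity constant
σ(b) and the within-block phase modulus
floor |E[ω^{N_b} | ξ, η]| ≥ c(b), the aperture θ(b), and the identification of the contracted
direction with u — all wait for the two
definition requests and are layer-2 children of EdgeCoherence; the character selection and the
re-proof of Prop. 8.6 / Prop. 4 for the
tree's fkInterface (children of CoherentMorera); bulk bound vs. equicontinuity (children of
EdgePrecompact); everything inside #8 below S5/S6 (the Picard/Darboux potential machinery is LANDED;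
pin uniformity and the KS box-tightness of the self-touching medial polyline are the two foreseen
children) and the diagonal-collar STUB E of #9; #5's interior is moot for the route.

CHEAPEST FALSIFIER. Monte-Carlo the binned block matrix at ONE block ratio (b = 4) with coarse bins
(4 sectors × 2 arm topologies for the crossing data at radii
R and R/4): explore percolation hulls in an L = 256–512 box of bond-ℤ² at p = 1/2, collect ~10⁵
passages within R of the centre, estimate
â(ξ,η) = Ê[ω^{N_4}; η | ξ] and test (a) min |â| / max |â| per row/column (σ < ∞, phase-modulus
floor) and (b) Dubois' four-pattern
inequality Re(conj(â_ξη)â_ξ′η′ + conj(â_ξη′)â_ξ′η) > |â_ξη â_ξ′η′ − â_ξη′ â_ξ′η| over all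
quadruples, recording the worst θ. Gross
failure on TYPICAL pattern pairs retires the mechanism (finer patterns only worsen typical
failures); margins of order one keep it. About a CPU-day; not run yet (no kit payload on the
planner seats). Lookup half done: nothing in Rugh2010 / Dubois2009 / HafoutaKifer2017 says twisted
arm-type kernels violate bounded aperture
generically; no percolation use of complex cones exists. For the rev-6 cut: (i) the numerical
exponent of the diagonal half-plane one-arm event of bond-ℤ² (exact enumeration / MC, n ≤ 4096): a
fitted exponent ≥ 0.36 or a visible log-drift retires DiagBoundaryArmLower AS TYPED (kill (8)); (ii)
|E_δ| vs lattice depth R next to a diagonal staircase arc vs a generic rough arc: slope −1/4 instead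
of −1/3 near the arc kills UniformInnerEnvelope; (iii) lookup: any printed KS/RSW crossing bound for
the self-touching medial exploration of bond-ℤ² (Binder–Chayes–Lei 2010 II treat the bond-triangular
analogue) shortens S6.

NUMBERS. Spin σ = 1 − (2/π)arccos(√q/2) = 1/3 at q = 1; κ = 6; ω = e^{2πi/3}; bulk two-arm exponent
x₂(0) = 1/4 vs. normalisation exponent x₂(1/3) =
1/4 + κ(1/3)²/8 = 1/3 (winding-phase gain 1/12); Dubois: Δ ≤ 8 log((1+θ)/(1−θ)) + 2 log σ,
contraction tanh(Δ/4) per block (θ = 0.2, σ = 1.5: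
Δ ≈ 4.05, tanh(Δ/4) ≈ 0.77; θ = 0.5, σ = 2: Δ ≈ 10.2, rate ≈ 0.988); separable block phases are free
up to ranges 3π/2 at spin 1/3
(cos(Δα/3)cos(Δβ/3) > 0); typical per-block phase spread (1/3)√((κ/4) ln b) ≈ 0.48 rad at b = 4,
0.68 rad at b = 16; turn-resolution matrix at
a medial vertex has det = e^{−iπ/3} − e^{iπ/3} = −i√3. Items: rev 3 (cone repair 2026-08-15; imports
MedialWinding + SLE only) = 13, closes hG (hS (hM hC hP).1 (hM hC hP).2); rev 6 (badge repair
2026-08-17) adds DiagBoundaryArmLower r7, UniformInnerEnvelope r7, SharpInputsGiveDiagSLESix r8,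
DiagSLESixGivesCardy r9 and closes := h4 (h3 hN hU hC hP) — 6 load-bearing binders (Sketch.lean rc
0, axioms propext / Classical.choice / Quot.sound; BC7 probes 4/4 CLEAN, #9 informational
summit-implies); informal stmt-8879/8880 dropped.

DEFINITION REQUESTS. D1 TwistedArmBlockKernel (new object for this problem; topic
Summits/CriticalPhenomena/CardyFormulaZ2/Theorems): collar patterns with
crossing data of the exploration hull on the circle of radius r about z (sector, arm topology,
crossing directions), the two-arm block event
between radii r and r/b, the integer winding increment N_b of the hull pieces inside the block (well
defined by angle telescoping across the
cuts — card P1), and the twisted block kernel a_b(ξ,η) = E[ω^{N_b}·1_η | ξ, two-arm compatible]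
under bondPercolation (zdGraph 2) half; needed
to type UniformConeCondition and MarkovBlockPresentation. D2 ComplexBirkhoffCone (topic
Literature/Dynamics/TransferOperators): Rugh's cone ℂⁿ₊ = {v : Re(v_k v̄_l) ≥ 0},
Dubois' projective metric δ_C and the contraction principle / diameter bound as cite facts
(Dubois2009 Thm 2.3, 3.6; Rugh2010 Thm 8.4). D3 ZdDiscretisationFamily + MedialWinding homes: LANDED
2026-08-15. Informal items UniformConeCondition (K1 ∧ K2: uniform aperture θ(b) < 1 and σ(b) < ∞ on
a good sub-cone) and MarkovBlockPresentation (K3: exact Markov product presentation over collar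
patterns ⇒ EdgeCoherence with ComplexConeContraction) were filed at open and DROPPED untyped at rev
6 (see TWO-LAYER PLAN).

Novelty: Searches (2026-08-15): `lit galaxy search "complex Perron-Frobenius" --star all` (6:
HafoutaKifer2017 book, DemersLiverani2025, Demers–Kiamari–
Liverani notes, Mayer–Urbański–Zdunik, Ivrii–Urbański, Akter–Urbański — complex cones in dynamics
only, 0 crabby); `lit search --hybrid
"complex cones projective metric contraction transfer operator percolation winding"` (12 held books,
none relevant); `lit vsearch "Hilbert
projective metric or Birkhoff cone contraction applied to a lattice statistical mechanics model …"`
(10, none relevant); `lit frontier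
CriticalPhenomena --since 2021` (30 descendants, none on complex cones or the q = 1 parafermion);
`lit read arxiv:0811.2930` pp. 1–13 (Def. 2,
Lemmas 2.1–2.2, Thm 2.3, Lemmas 3.1–3.2, Prop. 3.3, Prop. 3.5, Thm 3.6 — the engine statement was
extracted and checked by hand, incl. the
rectangular reading); the card's own galaxy sweep (Rugh/Dubois/Birkhoff cone/Hilbert projective
metric: dynamics, random matrix products,
Sinkhorn — no percolation) and the in-ledger comparison with all 142 cards of the conjunct (no cone
/ projective-metric technique_class) and
the 38 Theses files (grep Perron|Birkhoff|cone contraction|projective metric: only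
CardyPerronTeleport, an unrelated commuting-transfer-matrix
Perron vector).
Nearest prior art found: Dubois2009 (arXiv:0811.2930) and Rugh2010 — the tool, for matrices /
transfer operators of dynamical systems;
HafoutaKifer2017 and DemersLiverani2025 (arXiv:2502.07765) — complex / projective cones alo  [refs: 0811.2930, 2502.07765, 0711.4948, arxiv:0811.2930, HafoutaKifer2017, DemersLiverani2025, Dubois2009, Rugh2010, Nolin2008]

Barriers (technique_class: complex-cone-contraction, projective-metric, parafermion): - technique_class: complex-cone-contraction, projective-metric, parafermion
- Literature.Barriers.CriticalPhenomena.FKParafermionicHalfCauchyRiemann: evaded by construction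
(the file's evasion (b)): F_δ is never DETERMINED from the vertex relations + boundary values
(technique class halfCRSolutions); the dual half arrives asymptotically — a positivity-type
contraction principle pins the sublattice DIRECTION across scales (EdgeCoherence) and Morera at
leading order does the rest (CoherentMorera); no second same-size identity is sought.
- Literature.Barriers.CriticalPhenomena.FKParafermionicHalfCauchyRiemannNarrow: same evasion —
closedness of the edge form is used only as the KNOWN input of the sublattice Morera step; the new
input is an asymptotic rank-one statement about conditional winding phases, outside the closed-form
class the Narrow form characterises.
- Literature.Barriers.CriticalPhenomena.ParafermionicHalfCauchyRiemann: the hexagonal SAW companion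
of the same shape; nothing here concerns SAW, but its audit names exactly the inputs this route
files — "Morera identification of an orientation-coherent locally uniform subsequential limit is NOT
blocked … the missing inputs are precompactness and orientation coherence, asymptotic statements
rather than lattice identities" (DCS 2012 §4: vanishing curl ⟺ the same limit regardless of the
orientation of the edge) — EdgeCoherence / EdgePrecompact are those two inputs for q = 1 on ℤ², and
the cone contraction is a mechanism fo

History (route lifecycle, newest last):
- 2026-08-15T16:55:12Z · rev 2: restated Target (stmt-CriticalPhenomena-8785), EdgeCoherence (stmt-CriticalPhenomena-8786), EdgePrecompact (stmt-CriticalPhenomena-8787), CoherentMorera (stmt-CriticalPhenomena-8788), Assembly (stmt-CriticalPhenomena-8790) — route-repair (cone, rev 2) by unit rrepair-CriticalPhenomena-CardyComplex-acd27aeb-g2: R (planner-rrepair-CriticalPhenomena-CardyComplex-acd27aeb-g2-0)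
- 2026-08-15T16:55:12Z · rev 2: dropped stmt-CriticalPhenomena-5651, stmt-CriticalPhenomena-0697 — route-repair (cone, rev 2) by unit rrepair-CriticalPhenomena-CardyComplex-acd27aeb-g2: RE-ROUTED AROUND the unproved cone facts. (i) imports InterfaceScalingLim (planner-rrepair-CriticalPhenomena-CardyComplex-acd27aeb-g2-0)
- 2026-08-15T17:34:17Z · rev 3: restated Target (stmt-CriticalPhenomena-11263), EdgeCoherence (stmt-CriticalPhenomena-11264), EdgePrecompact (stmt-CriticalPhenomena-11265), CoherentMorera (stmt-CriticalPhenomena-11266), ParafermionToSLESixFamilies (stmt-CriticalPhenomena-11268) — route-repair (cone, rev 3) by unit rrepair-CriticalPhenomena-Car (planner-rrepair-CriticalPhenomena-CardyComplex-acd27aeb-g3-0)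
- 2026-08-17T14:45:17Z · skeleton.hides-summit: slesixAllFamilies_iff (stmt-CriticalPhenomena-11389) ⟷ summit (accepted theorem in Summits/CriticalPhenomena/CardyFormulaZ2/Theorems/CardyComplexConeParafermionToSLESixFamiliesSummitStrength.lean) (planner-cstrat-stmt-CriticalPhenomena-11389-r1-0)
- 2026-08-17T15:58:23Z · rev 7: dropped stmt-CriticalPhenomena-8879, stmt-CriticalPhenomena-8880 — route-repair (badge g3), cap room for the corrected crux C′: drop the two INFORMAL, never-typed support items UniformConeCondition (stmt-8879) and MarkovBlockPr (planner-rbadge-CriticalPhenomena-CardyComplexC-acd27aeb-g3-0)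
- 2026-08-26T16:12:37Z · DORMANT — reconciler: no traction for 6.2 d (last activity item-proof-filed at 2026-08-20T11:59:15Z); parked, not closed — `ledger route dormant route-CriticalPhenomena-C (operator:999:47955)

sub-problem: CardyFormulaZ2 · status: dormant · opened planner-plancard-CriticalPhenomena-CardyFormu-27975648-0 2026-08-15T13:32:46Z · rev 10 · ledger route-CriticalPhenomena-CardyComplexCone
GENERATED by the gate from the ledger (D-0016/17). Provers cite these decls: `theorem foo : Summit.CriticalPhenomena.CardyFormulaZ2.Theses.CardyComplexCone.<Decl> := …` in Summits/CriticalPhenomena/CardyFormulaZ2/Theorems/<Name>.lean.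
-/

namespace Summit.CriticalPhenomena.CardyFormulaZ2.Theses.CardyComplexCone

open scoped BigOperators Topology Manifold Classical MeasureTheory ProbabilityTheory Matrix InnerProductSpace ComplexConjugate ContinuousMap
open Filter Set Function TopologicalSpace MeasureTheory

attribute [summit_statement] _root_.CardyFormulaZ2

-- earlier Target (stmt-CriticalPhenomena-11263, replaced 2026-08-15T17:34:17Z -> stmt-CriticalPhenomena-11384): retired by None — (∃ u : Literature.Probability.LatticeModels.Site 2 → ℂ, (∃ o : Literature.Probability.LatticeModels.Site 2, Literature.Probability.LatticeModels.IsCorner 0 o ∧ u o ≠ 0) ∧ ∀ (D : Literature.Probability.RandomPlanarGeometry.DobrushinDomain) (Λ : ℝ → Literature.Probability.L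
-- earlier Target (stmt-CriticalPhenomena-8785, replaced 2026-08-15T16:55:12Z -> stmt-CriticalPhenomena-11263): retired by None — (∃ u : Literature.Probability.LatticeModels.Site 2 → ℂ, (∃ o : Literature.Probability.LatticeModels.Site 2, Literature.Probability.LatticeModels.IsCorner 0 o ∧ u o ≠ 0) ∧ ∀ (D : Literature.Probability.RandomPlanarGeometry.DobrushinDomain), (∀ᶠ δ in nhdsWithin (0:ℝ) (Set.Io
/-- item stmt-CriticalPhenomena-11384 · target · rank 0 · open · by planner
why it might fail: EdgeCoherence is DCS Conjecture 8.7 read projectively class by class; a universal direction may fail to exist (wandering sublattice phases) or only a degenerate one may, and δ^{1/3} may be the wrong envelope for a signed edge observable.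
sources: DuminilCopinSmirnov2012Lattice, DuminilCopin2012Parafermion, Dubois2009, Rugh2010
[target] X = EdgeCoherence ∧ EdgePrecompact, both conjuncts spelled out in their own blocks below
(rev 2, family form: for every Dobrushin domain D and every discretisation family Λ : ℝ →
DiscreteDobrushin with (Λ δ).Ω = D, mesh δ and ℤ²-admissible data for all small δ > 0 — arbitrary
admissible arcs —, γ = medialExploration (Λ δ) (= fkInterface unfolded); the rev-0/1 canonical data
dobrushinData D δ behind the guard `∀ᶠ δ, IsZdAdmissible` are inadmissible at every mesh on the unit
disc and along δ_k → 0⁺ on axis-aligned rectangles (CanonicalDiscretisationTies.lean,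
InterfaceScalingLimitDiscretised.lean §2), which made the guarded items generically vacuous). (rev
3, cone repair 2026-08-15: stated over the fact-free module MedialWinding — γ = medialExploration (Λ
δ), the definiens of the abbrev fkInterface; winding / passageSum are the exported aliases of
Polyline.winding / MedialPath.passageSum — so that FermionicObservable and its unproved FK-Ising
fact isSHolomorphic_fkIsingObservable leave the import cone; mathematical content unchanged) -/
@[route_item "route-CriticalPhenomena-CardyComplexCone"]
def Target : Prop :=
  (∃ u : Literature.Probability.LatticeModels.Site 2 → ℂ, (∃ o : Literature.Probability.LatticeModels.Site 2, Literature.Probability.LatticeModels.IsCorner 0 o ∧ u o ≠ 0) ∧ ∀ (D : Literature.Probability.RandomPlanarGeometry.DobrushinDomain) (Λ : ℝ → Literature.Probability.LatticeModels.DiscreteDobrushin), (∀ δ, (Λ δ).Ω = D.carrier) → (∀ δ, (Λ δ).δ = δ) → (∀ᶠ δ in nhdsWithin (0:ℝ) (Set.Ioi 0), (Λ δ).IsZdAdmissible) → let E : ℝ → Literature.Probability.LatticeModels.Site 2 → Literature.Probability.LatticeModels.Site 2 → ℂ := fun δ v f => ∫ ω, (let γ := Literature.Probability.LatticeModels.medialExploration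 (Λ δ) ω; ∑ k ∈ (Finset.range γ.length).filter (fun k => γ[k]? = some (Literature.Probability.LatticeModels.cornerSource v f) ∧ γ[k + 1]? = some (Literature.Probability.LatticeModels.cornerTarget v f)), Complex.exp (-(Complex.I / 3) * ((Literature.Probability.LatticeModels.winding ((γ.map (Literature.Probability.LatticeModels.medialPoint δ)).take (k + 2)) : ℝ) : ℂ))) ∂(Literature.Probability.Percolation.bondPercolation (Literature.Probability.LatticeModels.zdGraph 2) Literature.Probability.Percolation.half); ∀ K : Set ℂ, IsCompact K → K ⊆ D.carrier → ∀ ε > (0:ℝ), ∀ᶠ δ in nhdsWithin (0:ℝ) (Set.Ioi 0), ∀ v f f' : Literature.Probability.LatticeModels.Site 2, Literature.Probability.LatticeModels.IsCorner v f → Literature.Probability.LatticeModels.IsCorner v f' → Literature.Probability.LatticeModels.meshPoint δ v ∈ K → ‖u (f' - v) * E δ v f - u (f - v) * E δ v f'‖ ≤ ε * δ ^ ((1:ℝ) / 3)) ∧ (∀ (D : Literature.Probability.RandomPlanarGeometry.DobrushinDomain) (Λ : ℝ → Literature.Probability.LatticeModels.DiscreteDobrushin), (∀ δ, (Λ δ).Ω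 = D.carrier) → (∀ δ, (Λ δ).δ = δ) → (∀ᶠ δ in nhdsWithin (0:ℝ) (Set.Ioi 0), (Λ δ).IsZdAdmissible) → let E : ℝ → Literature.Probability.LatticeModels.Site 2 → Literature.Probability.LatticeModels.Site 2 → ℂ := fun δ v f => ∫ ω, (let γ := Literature.Probability.LatticeModels.medialExploration (Λ δ) ω; ∑ k ∈ (Finset.range γ.length).filter (fun k => γ[k]? = some (Literature.Probability.LatticeModels.cornerSource v f) ∧ γ[k + 1]? = some (Literature.Probability.LatticeModels.cornerTarget v f)), Complex.exp (-(Complex.I / 3) * ((Literature.Probability.LatticeModels.winding ((γ.map (Literature.Probability.LatticeModels.medialPoint δ)).take (k + 2)) : ℝ) : ℂ))) ∂(Literature.Probability.Percolation.bondPercolation (Literature.Probability.LatticeModels.zdGraph 2) Literature.Probability.Percolation.half); ∀ K : Set ℂ, IsCompact K → K ⊆ D.carrier → (∃ C : ℝ, ∀ᶠ δ in nhdsWithin (0:ℝ) (Set.Ioi 0), ∀ v f : Literature.Probability.LatticeModels.Site 2, Literature.Probability.LatticeModels.IsCorner v f → Literature.Probability.LatticeModels.meshPoint δ v ∈ K →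 ‖E δ v f‖ ≤ C * δ ^ ((1:ℝ) / 3)) ∧ (∀ ε > (0:ℝ), ∃ η > (0:ℝ), ∀ᶠ δ in nhdsWithin (0:ℝ) (Set.Ioi 0), ∀ v f v' f' : Literature.Probability.LatticeModels.Site 2, Literature.Probability.LatticeModels.IsCorner v f → Literature.Probability.LatticeModels.IsCorner v' f' → f - v = f' - v' → Literature.Probability.LatticeModels.meshPoint δ v ∈ K → Literature.Probability.LatticeModels.meshPoint δ v' ∈ K → dist (Literature.Probability.LatticeModels.meshPoint δ v) (Literature.Probability.LatticeModels.meshPoint δ v') < η → ‖E δ v f - E δ v' f'‖ ≤ ε * δ ^ ((1:ℝ) / 3)))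

-- earlier EdgeCoherence (stmt-CriticalPhenomena-11264, replaced 2026-08-15T17:34:17Z -> stmt-CriticalPhenomena-11385): retired by None — ∃ u : Literature.Probability.LatticeModels.Site 2 → ℂ, (∃ o : Literature.Probability.LatticeModels.Site 2, Literature.Probability.LatticeModels.IsCorner 0 o ∧ u o ≠ 0) ∧ ∀ (D : Literature.Probability.RandomPlanarGeometry.DobrushinDomain) (Λ : ℝ → Literature.Probabi
-- earlier EdgeCoherence (stmt-CriticalPhenomena-8786, replaced 2026-08-15T16:55:12Z -> stmt-CriticalPhenomena-11264): retired by None — ∃ u : Literature.Probability.LatticeModels.Site 2 → ℂ, (∃ o : Literature.Probability.LatticeModels.Site 2, Literature.Probability.LatticeModels.IsCorner 0 o ∧ u o ≠ 0) ∧ ∀ (D : Literature.Probability.RandomPlanarGeometry.DobrushinDomain), (∀ᶠ δ in nhdsWithin (0:ℝ) (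
/-- item stmt-CriticalPhenomena-11385 · crux · rank 2 · open · by planner
why it might fail: rank-one asymptotics of a twisted (non-positive) scale chain can fail if the two-arm chain mixes slower than 2^{−1/12} per scale in every usable sense; then the class phases wander with (Ω, z, δ) and no universal u exists — this also sinks DCS Conj. 8.7.
sources: DuminilCopinSmirnov2012Lattice, DuminilCopin2012Parafermion, Dubois2009, Kesten1987Scaling, GarbanPeteSchramm2013, Zhou2024SLE6BondZ2
[crux] There is a universal class vector u : (offsets) → ℂ, non-zero on at least one of the four
corner classes {0,−e₀,−e₁,−e₀−e₁}, such that for every Dobrushin domain D, every discretisation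
family Λ of D ((Λ δ).Ω = D, mesh δ, ℤ²-admissible for all small δ; arbitrary admissible arcs), every
compact K ⊂ D and every ε > 0, eventually as δ → 0⁺: for every primal vertex v with δv ∈ K and all
faces f, f′ cornered at v, ‖u(f′−v)·E_δ(v,f) − u(f−v)·E_δ(v,f′)‖ ≤ ε·δ^{1/3}, where E_δ(v,f) =
E[Σ_{k : γ_k = cornerSource v f, γ_{k+1} = cornerTarget v f} exp(−(i/3)·winding(γ[0..k+1]))] under
bondPercolation (zdGraph 2) half, γ = medialExploration (Λ δ) (= fkInterface unfolded; card:
COHERENCE = projective convergence of the χ-block; the output of the cone contraction). [difficulty: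
open-problem] (rev 2, family form: for every Dobrushin domain D and every discretisation family Λ :
ℝ → DiscreteDobrushin with (Λ δ).Ω = D, mesh δ and ℤ²-admissible data for all small δ > 0 —
arbitrary admissible arcs —, γ = medialExploration (Λ δ); the rev-0/1 canonical data dobrushinData D
δ behind the guard `∀ᶠ δ, IsZdAdmissible` are inadmissible at every mesh on the unit disc and along
δ_k → 0⁺ on axis-aligned r -/
@[route_item "route-CriticalPhenomena-CardyComplexCone", crux]
def EdgeCoherence : Prop :=
  ∃ u : Literature.Probability.LatticeModels.Site 2 → ℂ, (∃ o : Literature.Probability.LatticeModels.Site 2, Literature.Probability.LatticeModels.IsCorner 0 o ∧ u o ≠ 0) ∧ ∀ (D : Literature.Probability.RandomPlanarGeometry.DobrushinDomain) (Λ : ℝ → Literature.Probability.LatticeModels.DiscreteDobrushin), (∀ δ, (Λ δ).Ω = D.carrier) → (∀ δ, (Λ δ).δ = δ) → (∀ᶠ δ in nhdsWithin (0:ℝ) (Set.Ioi 0), (Λ δ).IsZdAdmissible) → let E : ℝ → Literature.Probability.LatticeModels.Site 2 → Literature.Probability.LatticeModels.Site 2 → ℂ := fun δ v f => ∫ ω,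 (let γ := Literature.Probability.LatticeModels.medialExploration (Λ δ) ω; ∑ k ∈ (Finset.range γ.length).filter (fun k => γ[k]? = some (Literature.Probability.LatticeModels.cornerSource v f) ∧ γ[k + 1]? = some (Literature.Probability.LatticeModels.cornerTarget v f)), Complex.exp (-(Complex.I / 3) * ((Literature.Probability.LatticeModels.winding ((γ.map (Literature.Probability.LatticeModels.medialPoint δ)).take (k + 2)) : ℝ) : ℂ))) ∂(Literature.Probability.Percolation.bondPercolation (Literature.Probability.LatticeModels.zdGraph 2) Literature.Probability.Percolation.half); ∀ K : Set ℂ, IsCompact K → K ⊆ D.carrier → ∀ ε > (0:ℝ), ∀ᶠ δ in nhdsWithin (0:ℝ) (Set.Ioi 0), ∀ v f f' : Literature.Probability.LatticeModels.Site 2, Literature.Probability.LatticeModels.IsCorner v f → Literature.Probability.LatticeModels.IsCorner v f' → Literature.Probability.LatticeModels.meshPoint δ v ∈ K → ‖u (f' - v) * E δ v f - u (f - v) * E δ v f'‖ ≤ ε * δ ^ ((1:ℝ) / 3)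

-- earlier EdgePrecompact (stmt-CriticalPhenomena-11265, replaced 2026-08-15T17:34:17Z -> stmt-CriticalPhenomena-11387): retired by None — ∀ (D : Literature.Probability.RandomPlanarGeometry.DobrushinDomain) (Λ : ℝ → Literature.Probability.LatticeModels.DiscreteDobrushin), (∀ δ, (Λ δ).Ω = D.carrier) → (∀ δ, (Λ δ).δ = δ) → (∀ᶠ δ in nhdsWithin (0:ℝ) (Set.Ioi 0), (Λ δ).IsZdAdmissible) → let E : ℝ → Liter
-- earlier EdgePrecompact (stmt-CriticalPhenomena-8787, replaced 2026-08-15T16:55:12Z -> stmt-CriticalPhenomena-11265): retired by None — ∀ (D : Literature.Probability.RandomPlanarGeometry.DobrushinDomain), (∀ᶠ δ in nhdsWithin (0:ℝ) (Set.Ioi 0), (Literature.Probability.Percolation.dobrushinData D δ).IsZdAdmissible) → let E : ℝ → Literature.Probability.LatticeModels.Site 2 → Literature.Probability.Lat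
/-- item stmt-CriticalPhenomena-11387 · crux · rank 3 · open · by planner
why it might fail: ‖E_δ‖ ≤ P(edge ∈ γ) ≍ δ^{1/4} ≫ δ^{1/3}: the bound needs winding-phase cancellation of order δ^{1/12} uniformly up to mesoscopic distance from ∂K, with no s-holomorphic primitive (the q = 2 tool); a staggered lattice-scale component would break (ii).
sources: DuminilCopinSmirnov2012Lattice, Smirnov2010, Zhou2024SLE6BondZ2, SchrammSteif2010
[crux] For every such D, Λ (discretisation family: (Λ δ).Ω = D, mesh δ, eventually ℤ²-admissible)
and compact K ⊂ D: (i) ∃ C, eventually in δ, ‖E_δ(v,f)‖ ≤ C·δ^{1/3} for every corner (v,f) with δv ∈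
K; (ii) ∀ ε > 0 ∃ η > 0, eventually in δ, ‖E_δ(v,f) − E_δ(v′,f′)‖ ≤ ε·δ^{1/3} for corners of the
SAME class (f − v = f′ − v′) with δv, δv′ ∈ K at distance < η — δ^{−1/3}E_δ is precompact class by
class (the edge form of CardySusyWard's ParafermionPrecompact, which it yields inside
CoherentMorera). [difficulty: XL] E_δ as in EdgeCoherence, γ = medialExploration (Λ δ). (rev 3, cone
repair 2026-08-15: stated over the fact-free module MedialWinding — γ = medialExploration (Λ δ), the
definiens of the abbrev fkInterface; winding / passageSum are the exported aliases of
Polyline.winding / MedialPath.passageSum — so that FermionicObservable and its unproved FK-Ising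
fact isSHolomorphic_fkIsingObservable leave the import cone; mathematical content unchanged) -/
@[route_item "route-CriticalPhenomena-CardyComplexCone", crux]
def EdgePrecompact : Prop :=
  ∀ (D : Literature.Probability.RandomPlanarGeometry.DobrushinDomain) (Λ : ℝ → Literature.Probability.LatticeModels.DiscreteDobrushin), (∀ δ, (Λ δ).Ω = D.carrier) → (∀ δ, (Λ δ).δ = δ) → (∀ᶠ δ in nhdsWithin (0:ℝ) (Set.Ioi 0), (Λ δ).IsZdAdmissible) → let E : ℝ → Literature.Probability.LatticeModels.Site 2 → Literature.Probability.LatticeModels.Site 2 → ℂ := fun δ v f => ∫ ω, (let γ := Literature.Probability.LatticeModels.medialExploration (Λ δ) ω; ∑ k ∈ (Finset.range γ.length).filter (fun k => γ[k]? = some (Literature.Probability.LatticeModels.cornerSource v f) ∧ γ[k + 1]? = some (Literature.Probability.LatticeModels.cornerTarget v f)), Complex.exp (-(Complex.I / 3) * ((Literature.Probability.LatticeModels.winding ((γ.map (Literature.Probability.LatticeModels.medialPoint δ)).take (k + 2)) : ℝ) : ℂ))) ∂(Literature.Probability.Percolation.bondPercolation (Literature.Probability.LatticeModels.zdGraph 2)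 Literature.Probability.Percolation.half); ∀ K : Set ℂ, IsCompact K → K ⊆ D.carrier → (∃ C : ℝ, ∀ᶠ δ in nhdsWithin (0:ℝ) (Set.Ioi 0), ∀ v f : Literature.Probability.LatticeModels.Site 2, Literature.Probability.LatticeModels.IsCorner v f → Literature.Probability.LatticeModels.meshPoint δ v ∈ K → ‖E δ v f‖ ≤ C * δ ^ ((1:ℝ) / 3)) ∧ (∀ ε > (0:ℝ), ∃ η > (0:ℝ), ∀ᶠ δ in nhdsWithin (0:ℝ) (Set.Ioi 0), ∀ v f v' f' : Literature.Probability.LatticeModels.Site 2, Literature.Probability.LatticeModels.IsCorner v f → Literature.Probability.LatticeModels.IsCorner v' f' → f - v = f' - v' → Literature.Probability.LatticeModels.meshPoint δ v ∈ K → Literature.Probability.LatticeModels.meshPoint δ v' ∈ K → dist (Literature.Probability.LatticeModels.meshPoint δ v) (Literature.Probability.LatticeModels.meshPoint δ v') < η → ‖E δ v f - E δ v' f'‖ ≤ ε * δ ^ ((1:ℝ) / 3))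

-- earlier CoherentMorera (stmt-CriticalPhenomena-11266, replaced 2026-08-15T17:34:17Z -> stmt-CriticalPhenomena-11388): retired by None — EdgeCoherence → EdgePrecompact → (∀ (D : Literature.Probability.RandomPlanarGeometry.DobrushinDomain) (Λ : ℝ → Literature.Probability.LatticeModels.DiscreteDobrushin), (∀ δ, (Λ δ).Ω = D.carrier) → (∀ δ, (Λ δ).δ = δ) → (∀ᶠ δ in nhdsWithin (0:ℝ) (Set.Ioi 0), (Λ δ).I
-- earlier CoherentMorera (stmt-CriticalPhenomena-8788, replaced 2026-08-15T16:55:12Z -> stmt-CriticalPhenomena-11266): retired by None — EdgeCoherence → EdgePrecompact → (∀ (D : Literature.Probability.RandomPlanarGeometry.DobrushinDomain), (∀ᶠ δ in nhdsWithin (0:ℝ) (Set.Ioi 0), (Literature.Probability.Percolation.dobrushinData D δ).IsZdAdmissible) → ∀ (φ : ℂ → ℂ), ContDiff ℝ (⊤ : ℕ∞) φ → HasCompactS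
/-- item stmt-CriticalPhenomena-11388 · crux · rank 4 · closed · proved by Summit.CriticalPhenomena.CardyFormulaZ2.Cruxes.CoherentMorera.FinitaryGreenPairing.CoherentMorera_proof (prover) · by planner
why it might fail: u may be the WRONG character: real but anti-conformal (then conj F_δ, spin −1/3, is the holomorphic one — a convention repair shared with CardySusyWard), or χ = ±i / degenerate even part, where Morera gives nothing and the vertex observable staggers between medial sublattices.
sources: DuminilCopin2012Parafermion, DuminilCopinSmirnov2012Lattice, arXiv:0810.5037, Beffara2008Universal, lean:Literature.Barriers.CriticalPhenomena.FKParafermionicHalfCauchyRiemann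
[crux] EdgeCoherence → EdgePrecompact → (WeakHolomorphy ∧ ParafermionPrecompact), both conclusions
the FAMILY forms (same families Λ as in EdgeCoherence / EdgePrecompact) of the rank-2 / rank-3
cruxes WeakHolomorphy / ParafermionPrecompact of route CardySusyWard for the spin-1/3 VERTEX
observable F_δ = ∫ passageSum (medialExploration (Λ δ) ω) δ (1/3) z (δ^{5/3}·Σ_z F_δ(z)·∂̄φ(z_δ) → 0
for every φ ∈ C_c^∞(D); δ^{−1/3}F_δ locally bounded and equicontinuous on lattice edges z, z′ ∈
(zdGraph 2).edgeSet). Intended proof = the companion card's F2 "Morera with sublattices": each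
passage through a medial vertex arrives along one of two corners and turns ±π/2 (windingAt =
departure winding ∓ π/4), so F_δ(z) = (2cos(π/12))⁻¹ Σ_{c∼z} E_δ(c) exactly (refuter note: no 4×4
turn-resolved inversion is needed) and bounds / same-class equicontinuity transfer from corners to
vertices unconditionally, every medial vertex carrying one corner of each class; subsequential class
limits f_o = u(o)·f exist by EdgePrecompact + EdgeCoherence; exact closedness of the edge form (DC
2012 Prop. 4, re-proved for the tree's medialExploration / bcBondConfig conventions) forces ∂_t B =
i∂_s A for the even combination -/
@[route_item "route-CriticalPhenomena-CardyComplexCone"]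
def CoherentMorera : Prop :=
  EdgeCoherence → EdgePrecompact → (∀ (D : Literature.Probability.RandomPlanarGeometry.DobrushinDomain) (Λ : ℝ → Literature.Probability.LatticeModels.DiscreteDobrushin), (∀ δ, (Λ δ).Ω = D.carrier) → (∀ δ, (Λ δ).δ = δ) → (∀ᶠ δ in 𝓝[>] (0:ℝ), (Λ δ).IsZdAdmissible) → ∀ (φ : ℂ → ℂ), ContDiff ℝ (⊤ : ℕ∞) φ → HasCompactSupport φ → tsupport φ ⊆ D.carrier → Tendsto (fun δ : ℝ => ((δ ^ ((5:ℝ) / 3) : ℝ) : ℂ) * ∑ᶠ z : Literature.Probability.LatticeModels.MedialVertex, (∫ ω, Literature.Probability.LatticeModels.passageSum (Literature.Probability.LatticeModels.medialExploration (Λ δ) ω) δ (1 / 3) z ∂(Literature.Probability.Percolation.bondPercolation (Literature.Probability.LatticeModels.zdGraph 2) Literature.Probability.Percolation.half)) * ((fderiv ℝ φ (Literature.Probability.LatticeModels.medialPoint δ z) 1 + Complex.I * fderiv ℝ φ (Literature.Probability.LatticeModels.medialPoint δ z) Complex.I) / 2)) (𝓝[>] (0:ℝ)) (𝓝 0)) ∧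 (∀ (D : Literature.Probability.RandomPlanarGeometry.DobrushinDomain) (Λ : ℝ → Literature.Probability.LatticeModels.DiscreteDobrushin), (∀ δ, (Λ δ).Ω = D.carrier) → (∀ δ, (Λ δ).δ = δ) → (∀ᶠ δ in 𝓝[>] (0:ℝ), (Λ δ).IsZdAdmissible) → let F : ℝ → Literature.Probability.LatticeModels.MedialVertex → ℂ := fun δ z => ∫ ω, Literature.Probability.LatticeModels.passageSum (Literature.Probability.LatticeModels.medialExploration (Λ δ) ω) δ (1 / 3) z ∂(Literature.Probability.Percolation.bondPercolation (Literature.Probability.LatticeModels.zdGraph 2) Literature.Probability.Percolation.half); ∀ K : Set ℂ, IsCompact K → K ⊆ D.carrier → (∃ C : ℝ, ∀ᶠ δ in 𝓝[>] (0:ℝ), ∀ z : Literature.Probability.LatticeModels.MedialVertex, z ∈ (Literature.Probability.LatticeModels.zdGraph 2).edgeSet → Literature.Probability.LatticeModels.medialPoint δ z ∈ K → ‖F δ z‖ ≤ C * δ ^ ((1:ℝ) / 3)) ∧ (∀ ε > (0:ℝ), ∃ η > (0:ℝ), ∀ᶠ δ in 𝓝[>] (0:ℝ), ∀ z z' : Literature.Probability.LatticeModels.MedialVertex,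 z ∈ (Literature.Probability.LatticeModels.zdGraph 2).edgeSet → z' ∈ (Literature.Probability.LatticeModels.zdGraph 2).edgeSet → Literature.Probability.LatticeModels.medialPoint δ z ∈ K → Literature.Probability.LatticeModels.medialPoint δ z' ∈ K → dist (Literature.Probability.LatticeModels.medialPoint δ z) (Literature.Probability.LatticeModels.medialPoint δ z') < η → ‖F δ z - F δ z'‖ ≤ ε * δ ^ ((1:ℝ) / 3)))

-- `CoherentMorera` holds: proved by `Summit.CriticalPhenomena.CardyFormulaZ2.Cruxes.CoherentMorera.FinitaryGreenPairing.CoherentMorera_proof` (its module imports this route file, so no `_holds` link can be stated here).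

/-- item stmt-CriticalPhenomena-9654 · crux · rank 6 · closed · proved by Summit.CriticalPhenomena.CardyFormulaZ2.Cruxes.SLESixFamiliesGiveCardy.CollarTouchSandwich.SLESixFamiliesGiveCardy_of (prover) · by planner
why it might fail: the free crossing event of discreteCrossing (largest component, distance-rule arcs with ties) must equal the Dobrushin hitting event up to o(1); at rough marked prime ends ℤ² boundary arm bounds may not control the difference, and a discretisation family must exist for every (Ω; a, c).
sources: CamiaNewman2007, Smirnov2001, LawlerSchrammWerner2001, Werner2009, AizenmanBurchard1999, lean:Literature.Probability.RandomPlanarGeometry.sle_six_measureReal_hitsBefore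
[crux] (SLE₆ for every Dobrushin domain and every discretisation family, =
SLE6LimitZ2AllDiscretisations) → CardyFormulaZ2: for a conformal rectangle R = (Ω; a, b, c, d) take
the Dobrushin domain (Ω; a, c), build an admissible discretisation family
(DiscretisationFamilyExists), identify the free-boundary discrete crossing (ab)_δ ↔ (cd)_δ of
bondDomainCrossingProb R with 'the interface hits (cd)_δ before (bc)_δ' up to boundary events killed
by half-plane arm / RSW bounds, use a.s. continuity of hitsBefore at SLE₆ samples and LSW's hitting
law = Cardy (Literature.Probability.RandomPlanarGeometry.sle_six_measureReal_hitsBefore,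
discharged). Template on 𝕋: Camia–Newman 2007 §§5–7, Smirnov 2001. [deps: ParafermionToSLESix,
DiscretisationFamilyExists] [difficulty: L] (why it might fail: the free crossing event of
discreteCrossing (largest component, distance-rule arcs with ties) must equal the Dobrushin hitting
event up to o(1); at rough marked prime ends ℤ² boundary arm bounds may not control the difference,
and a discretisation family must exist for every (Ω; a, c).) [sources: CamiaNewman2007, Smirnov2001,
LawlerSchrammWerner2001, Werner2009, AizenmanBurchard1999, lean:Literature.Proba -/
@[route_item "route-CriticalPhenomena-CardyComplexCone"]
def SLESixFamiliesGiveCardy : Prop :=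
  (∀ (D : Literature.Probability.RandomPlanarGeometry.DobrushinDomain) (Λ : ℝ → Literature.Probability.LatticeModels.DiscreteDobrushin), (∀ δ, (Λ δ).Ω = D.carrier) → (∀ δ, (Λ δ).δ = δ) → Filter.Tendsto (fun δ : ℝ => Metric.hausdorffEDist (Λ δ).arcA (D.arc 0)) (nhdsWithin (0:ℝ) (Set.Ioi 0)) (nhds 0) → Filter.Tendsto (fun δ : ℝ => Metric.hausdorffEDist (Λ δ).arcB (D.arc 1)) (nhdsWithin (0:ℝ) (Set.Ioi 0)) (nhds 0) → Filter.Tendsto (fun δ : ℝ => Metric.hausdorffEDist (Literature.Probability.LatticeModels.medialPoint δ '' (Λ δ).zdABEdges) {D.pt 0, D.pt 1}) (nhdsWithin (0:ℝ) (Set.Ioi 0)) (nhds 0) → (∀ᶠ δ in nhdsWithin (0:ℝ) (Set.Ioi 0), (Λ δ).IsZdAdmissible) → Literature.Probability.RandomPlanarGeometry.ConvergesInLawToSLE 6 D (Ωδ := fun _ => Literature.Probability.Percolation.BondConfig (Literature.Probability.LatticeModels.Site 2)) (fun δ ω => Literature.Probability.RandomPlanarGeometry.CurveClass.mk (if dist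 (Literature.Probability.LatticeModels.medialExplorationCurve (Λ δ) ω 0) (D.pt 0) ≤ dist (Literature.Probability.LatticeModels.medialExplorationCurve (Λ δ) ω 0) (D.pt 1) then (⟨Literature.Probability.LatticeModels.medialExplorationCurve (Λ δ) ω⟩ : Literature.Probability.RandomPlanarGeometry.Curve ℂ) else ⟨(Literature.Probability.LatticeModels.medialExplorationCurve (Λ δ) ω).comp ⟨unitInterval.symm, unitInterval.continuous_symm⟩⟩)) (fun _ => Literature.Probability.Percolation.bondPercolation (Literature.Probability.LatticeModels.zdGraph 2) Literature.Probability.Percolation.half)) → CardyFormulaZ2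

-- `SLESixFamiliesGiveCardy` holds: proved by `Summit.CriticalPhenomena.CardyFormulaZ2.Cruxes.SLESixFamiliesGiveCardy.CollarTouchSandwich.SLESixFamiliesGiveCardy_of` (its module imports this route file, so no `_holds` link can be stated here).

/-- item stmt-CriticalPhenomena-18394 · crux · rank 7 · open · by planner
why it might fail: The sharp boundary exponent 1/3 WITH CONSTANTS is open on bond-ℤ² even as n^{-1/3+o(1)} (no SLE₆); as typed, a logarithmic correction or a shape-dependent degeneration of c kills it; only IP12's conjectural strip law or a DGLZ24-type sharpness (site-T only) would give it.
sources: IkhlefPonsaing2012 (arXiv:1202.5476, strip first-passage law), arXiv:2205.15901 (Du–Gao–Li–Zhuang 2024, sharp arm asymptotics, site T), Zhou2024SLE6BondZ2 (arXiv:2409.03235), arXiv:1108.2784 (Grimmett–Manolescu, universality of arm exponents across bond models), LawlerSchrammWerner2001, lean:Summit.CriticalPhenomena.CardyFormulaZ2.Cruxes.ParafermionToSLESixFamilies.FlipInvolutionReturnLaw.diagArmLower_of_ikhlefPonsaing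
[crux] DIAGONAL HALF-PLANE ONE-ARM LOWER BOUND WITH CONSTANTS — input N of the summit cut of #5 (rev
6), verbatim FlipInvolutionReturnLaw.DiagHalfPlaneOneArmLower (strategists s1/s2/r1, child 1): there
is c > 0 such that for all large n the P_{1/2}-probability that the origin is joined by an open path
of bond-ℤ², staying inside the diagonal half-plane box {w : w₀+w₁ ≤ 1, −n ≤ w₀+w₁, |w₀−w₁| ≤ n}, to
the far side (w₀+w₁ = −n) or a lateral side (|w₀−w₁| = n) is ≥ c·n^{−1/3}. Feeds
SharpInputsGiveDiagSLESix through the LANDED freeTouchLower_of_diagArmLower and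
potentialConformalLimit_of_inputs (p169165). CONDITIONALLY PROVED from the named Literature
conjecture IkhlefPonsaingFirstPassage (diagArmLower_of_ikhlefPonsaing, p119507); unconditionally
open on ℤ² — the sharp κ = 6 boundary exponent 1/3 with constants is known only for site percolation
on T (via SLE₆; up-to-constants form DGLZ 2024). A refuter may try the numerical exponent (log-log
fit of the diagonal half-plane arm, n ≤ 4096) and the converse question whether any log-correction
is forced. [deps: none] [difficulty: open-problem] -/
@[route_item "route-CriticalPhenomena-CardyComplexCone", crux]
def DiagBoundaryArmLower : Prop :=
  ∃ c : ℝ, 0 < c ∧ ∀ᶠ n : ℕ in Filter.atTop, c * (n : ℝ) ^ (-((1:ℝ) / 3)) ≤ (Literature.Probability.Percolation.bondPercolation (Literature.Probability.LatticeModels.zdGraph 2) Literature.Probability.Percolation.half).real {ω | ∃ y : Literature.Probability.LatticeModels.Site 2, (y 0 + y 1 = -(n : ℤ) ∨ y 0 - y 1 = (n : ℤ) ∨ y 0 - y 1 = -(n : ℤ)) ∧ ω ∈ Literature.Probability.Percolation.openConnIn {v : Literature.Probability.LatticeModels.Site 2 | v 0 + v 1 ≤ 1 ∧ -(n : ℤ)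 ≤ v 0 + v 1 ∧ -(n : ℤ) ≤ v 0 - v 1 ∧ v 0 - v 1 ≤ n} 0 y}

/-- item stmt-CriticalPhenomena-18395 · crux · rank 7 · open · by planner
why it might fail: A priori ‖E_δ‖ ≤ P(edge ∈ γ) ≍ R^{-1/4} ≫ R^{-1/3}: the envelope needs a winding-phase cancellation of order R^{-1/12} UNIFORMLY up to rough admissible arcs and prime ends, where no strip comparison is available; one bad boundary geometry breaks the single constant C.
sources: DuminilCopinSmirnov2012Lattice (Conj. 8.7, Prop. 8.6), Smirnov2010, IkhlefPonsaing2012 (arXiv:1202.5476), Zhou2024SLE6BondZ2 (arXiv:2409.03235), stmt-CriticalPhenomena-11387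
[crux] UNIFORM INNER ENVELOPE — input of the summit cut of #5 (rev 6); 11387's milestone X1,
verbatim Cruxes.EdgePrecompact / CardyComplexConeDefs.UniformInnerEnvelope with cornerObs unfolded
(strategists' child 2, unbundled so that EdgeCoherence and EdgePrecompact stay binders of closes):
ONE constant C such that for every Jordan Dobrushin domain D, every ℤ²-admissible discretisation E
of D at any mesh δ > 0 (arbitrary admissible arcs) and every corner (v,f) at lattice depth R ≥ 1
(R·δ ≤ dist(δv, Dᶜ)), the spin-1/3 corner observable of γ = medialExploration E under P_{1/2} obeys
‖E_δ(v,f)‖ ≤ C·R^{−1/3} — the boundary-uniform (up-to-the-arcs) form of EdgePrecompact (i), which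
bounds only on compacts with an eventually-in-δ constant. Feeds SharpInputsGiveDiagSLESix through
the LANDED collar_of_uniformInnerEnvelope (ClosedCollar) and potentialConformalLimit_of_inputs
(p169165). Registered line on 11387: Cruxes/EdgePrecompact/Lines/qkz-strip-boundary-arm.lean
(twisted comparison with the Ikhlef–Ponsaing strip + half-plane arm bound). [deps: none; sibling of
EdgePrecompact] [difficulty: XL] -/
@[route_item "route-CriticalPhenomena-CardyComplexCone", crux]
def UniformInnerEnvelope : Prop :=
  ∃ C : ℝ, ∀ (D : Literature.Probability.RandomPlanarGeometry.DobrushinDomain) (E : Literature.Probability.LatticeModels.DiscreteDobrushin), E.Ω = D.carrier → E.IsZdAdmissible → ∀ v f : Literature.Probability.LatticeModels.Site 2, Literature.Probability.LatticeModels.IsCorner v f → ∀ R : ℕ, 1 ≤ R → (R : ℝ) * E.δ ≤ Metric.infDist (Literature.Probability.LatticeModels.meshPoint E.δ v) D.carrierᶜ → ‖(∫ ω, (let γ := Literature.Probability.LatticeModels.medialExploration E ω; ∑ k ∈ (Finset.range γ.length).filter (fun k => γ[k]? = some (Literature.Probability.LatticeModels.cornerSource v f) ∧ γ[k + 1]?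 = some (Literature.Probability.LatticeModels.cornerTarget v f)), Complex.exp (-(Complex.I / 3) * ((Literature.Probability.LatticeModels.Polyline.winding ((γ.map (Literature.Probability.LatticeModels.medialPoint E.δ)).take (k + 2)) : ℝ) : ℂ))) ∂(Literature.Probability.Percolation.bondPercolation (Literature.Probability.LatticeModels.zdGraph 2) Literature.Probability.Percolation.half))‖ ≤ C * (R : ℝ) ^ (-(1:ℝ) / 3)

/-- item stmt-CriticalPhenomena-18396 · crux · rank 8 · open · by planner
why it might fail: Pin/slit uniformity U (the identified potential's touch law, uniformly over the discrete slit domains along the exploration, two touch-corner layers per diagonal side) and KS17 precompactness (crossing bounds for the SELF-TOUCHING medial polyline of bond-ℤ²) can each fail with all four inputs true.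
sources: KemppainenSmirnov2017 (Thm 1.4, Cond. G2), DuminilCopinSmirnov2012Lattice (Conj. 8.7–8.8), DuminilCopin2012Parafermion (Prop. 5), Smirnov2010, CamiaNewman2007, arXiv:1004.4673 (Binder–Chayes–Lei 2010 I)
[crux] THE SHARP INPUTS GIVE SLE₆ ON ALL-DIAGONAL POLYGONS — the CORRECTED CRUX C′ replacing #5
ParafermionToSLESixFamilies on the critical path (route-repair rev 6, badge skeleton.hides-summit;
the strategists' s1/s2/r1 summit cut, child 3 with the CoherentEnvelope bundle unbundled):
DiagBoundaryArmLower → UniformInnerEnvelope → EdgeCoherence → EdgePrecompact → for every Dobrushin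
domain D whose frontier is a finite union of slope-±1 segments and every discretisation family Λ of
D ((Λ δ).Ω = D, mesh δ, arcs → (ab),(ba), marked edges → {a,b}, eventually ℤ²-admissible) the
endpoint-oriented medial exploration curve converges in law to chordal SLE₆ in D from a to b (Ωδ,
curve map and measure VERBATIM as in #5/#6). This is the live line potential-darboux-picard-diamond
(stmt-11389) CUT AT THE CURVE LAW ON DIAGONAL POLYGONS: S1/S2/S4′ LANDED
(exactPotentialTracePh_holds p162308; stub_argumentPrinciple; BoundaryIdentification p151443) and
potentialConformalLimit_of_inputs : UniformInnerEnvelope → EdgeCoherence → DiagHalfPlaneOneArmLower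
→ PotentialConformalLimit LANDED (OfLineInputs, p169165), so what remains is S5 pin/slit uniformity
U (stub_pinUniformity) + S6 Kemppainen–Smirnov trans -/
@[route_item "route-CriticalPhenomena-CardyComplexCone", crux]
def SharpInputsGiveDiagSLESix : Prop :=
  DiagBoundaryArmLower → UniformInnerEnvelope → EdgeCoherence → EdgePrecompact → (∀ (D : Literature.Probability.RandomPlanarGeometry.DobrushinDomain) (Λ : ℝ → Literature.Probability.LatticeModels.DiscreteDobrushin), (∃ S : Finset (ℂ × ℂ), (∀ e ∈ S, (e.1 - e.2).re = (e.1 - e.2).im ∨ (e.1 - e.2).re = -(e.1 - e.2).im) ∧ frontier D.carrier = ⋃ e ∈ S, segment ℝ e.1 e.2) → (∀ δ, (Λ δ).Ω = D.carrier) → (∀ δ, (Λ δ).δ = δ) → Tendsto (fun δ : ℝ => Metric.hausdorffEDist (Λ δ).arcA (D.arc 0)) (𝓝[>] (0:ℝ)) (𝓝 0) → Tendsto (fun δ : ℝ => Metric.hausdorffEDist (Λ δ).arcB (D.arc 1)) (𝓝[>] (0:ℝ)) (𝓝 0) → Tendsto (fun δ : ℝ => Metric.hausdorffEDist (Literature.Probability.LatticeModels.medialPoint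 δ '' (Λ δ).zdABEdges) {D.pt 0, D.pt 1}) (𝓝[>] (0:ℝ)) (𝓝 0) → (∀ᶠ δ in 𝓝[>] (0:ℝ), (Λ δ).IsZdAdmissible) → Literature.Probability.RandomPlanarGeometry.ConvergesInLawToSLE 6 D (Ωδ := fun _ => Literature.Probability.Percolation.BondConfig (Literature.Probability.LatticeModels.Site 2)) (fun δ ω => Literature.Probability.RandomPlanarGeometry.CurveClass.mk (if dist (Literature.Probability.LatticeModels.medialExplorationCurve (Λ δ) ω 0) (D.pt 0) ≤ dist (Literature.Probability.LatticeModels.medialExplorationCurve (Λ δ) ω 0) (D.pt 1) then (⟨Literature.Probability.LatticeModels.medialExplorationCurve (Λ δ) ω⟩ : Literature.Probability.RandomPlanarGeometry.Curve ℂ) else ⟨(Literature.Probability.LatticeModels.medialExplorationCurve (Λ δ) ω).comp ⟨unitInterval.symm, unitInterval.continuous_symm⟩⟩)) (fun _ => Literature.Probability.Percolation.bondPercolation (Literature.Probability.LatticeModels.zdGraph 2) Literature.Probability.Percolation.half))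

-- earlier ParafermionToSLESixFamilies (stmt-CriticalPhenomena-11268, replaced 2026-08-15T17:34:17Z -> stmt-CriticalPhenomena-11389): retired by None — (∀ (D : Literature.Probability.RandomPlanarGeometry.DobrushinDomain) (Λ : ℝ → Literature.Probability.LatticeModels.DiscreteDobrushin), (∀ δ, (Λ δ).Ω = D.carrier) → (∀ δ, (Λ δ).δ = δ) → (∀ᶠ δ in 𝓝[>] (0:ℝ), (Λ δ).IsZdAdmissible) → ∀ (φ : ℂ → ℂ), ContDi
/-- item stmt-CriticalPhenomena-11389 · aside · rank 5 · open · by planner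
why it might fail: interior inputs do not exclude the ZERO limit (δ^{-1/3}F_δ ⇀ 0): identification as c·(φ′)^{1/3}, c ≠ 0, needs free-arc modulus/argument control (a boundary layer, no F²-primitive at q = 1) on top of the slit-domain martingale, which needs the inputs uniformly over discrete slit domains.
sources: DuminilCopinSmirnov2012Lattice, KemppainenSmirnov2017, DuminilCopin2012Parafermion, Smirnov2010, Smirnov2007ICM, lean:Literature.Probability.Percolation.SLE6LimitZ2AllDiscretisations
[crux] FAMILY FORM of the shared crux ParafermionToSLESix (stmt-5651, which concluded the
canonical-data SLE6LimitZ2 and is dropped from this route): WeakHolomorphyFamilies →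
ParafermionPrecompactFamilies → (SLE₆ for every Dobrushin domain and every discretisation family,
verbatim the antecedent of SLESixFamiliesGiveCardy = SLE6LimitZ2AllDiscretisations spelled inline,
so that no open named fact enters the dependency cone). The two hypotheses are exactly the two
conjuncts of the conclusion of CoherentMorera (weak holomorphy at scale δ^{1/3} of the spin-1/3
vertex observable F_δ = ∫ passageSum (medialExploration (Λ δ) ω) δ (1/3) z, and local boundedness +
equicontinuity of δ^{−1/3}F_δ on lattice edges z, z′ ∈ (zdGraph 2).edgeSet, for all families with (Λ
δ).Ω = D, mesh δ, eventually ℤ²-admissible); the conclusion asks convergence in law of the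
endpoint-oriented medial exploration curve of Λ δ to chordal SLE₆ for families whose arcs and
discrete marked points moreover converge (the six ZdDiscretisationFamily fields, unbundled).
Intended proof: Weyl/Morera makes subsequential limits of δ^{−1/3}F_δ holomorphic; the free-arc
argument condition (DuminilCopin2012Parafermion Prop. 5) and t -/
@[route_item "route-CriticalPhenomena-CardyComplexCone"]
def ParafermionToSLESixFamilies : Prop :=
  (∀ (D : Literature.Probability.RandomPlanarGeometry.DobrushinDomain) (Λ : ℝ → Literature.Probability.LatticeModels.DiscreteDobrushin), (∀ δ, (Λ δ).Ω = D.carrier) → (∀ δ, (Λ δ).δ = δ) → (∀ᶠ δ in 𝓝[>] (0:ℝ), (Λ δ).IsZdAdmissible) → ∀ (φ : ℂ → ℂ), ContDiff ℝ (⊤ : ℕ∞) φ → HasCompactSupport φ → tsupport φ ⊆ D.carrier → Tendsto (fun δ : ℝ => ((δ ^ ((5:ℝ) / 3) : ℝ) : ℂ) * ∑ᶠ z : Literature.Probability.LatticeModels.MedialVertex, (∫ ω, Literature.Probability.LatticeModels.passageSum (Literature.Probability.LatticeModels.medialExploration (Λ δ) ω) δ (1 / 3) z ∂(Literature.Probability.Percolation.bondPercolation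 (Literature.Probability.LatticeModels.zdGraph 2) Literature.Probability.Percolation.half)) * ((fderiv ℝ φ (Literature.Probability.LatticeModels.medialPoint δ z) 1 + Complex.I * fderiv ℝ φ (Literature.Probability.LatticeModels.medialPoint δ z) Complex.I) / 2)) (𝓝[>] (0:ℝ)) (𝓝 0)) → (∀ (D : Literature.Probability.RandomPlanarGeometry.DobrushinDomain) (Λ : ℝ → Literature.Probability.LatticeModels.DiscreteDobrushin), (∀ δ, (Λ δ).Ω = D.carrier) → (∀ δ, (Λ δ).δ = δ) → (∀ᶠ δ in 𝓝[>] (0:ℝ), (Λ δ).IsZdAdmissible) → let F : ℝ → Literature.Probability.LatticeModels.MedialVertex → ℂ := fun δ z => ∫ ω, Literature.Probability.LatticeModels.passageSum (Literature.Probability.LatticeModels.medialExploration (Λ δ) ω) δ (1 / 3) z ∂(Literature.Probability.Percolation.bondPercolation (Literature.Probability.LatticeModels.zdGraph 2) Literature.Probability.Percolation.half); ∀ K : Set ℂ, IsCompact K → K ⊆ D.carrier → (∃ C : ℝ, ∀ᶠ δ in 𝓝[>] (0:ℝ), ∀ z : Literature.Probability.LatticeModels.MedialVertex, z ∈ (Literature.Probability.LatticeModels.zdGraph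 2).edgeSet → Literature.Probability.LatticeModels.medialPoint δ z ∈ K → ‖F δ z‖ ≤ C * δ ^ ((1:ℝ) / 3)) ∧ (∀ ε > (0:ℝ), ∃ η > (0:ℝ), ∀ᶠ δ in 𝓝[>] (0:ℝ), ∀ z z' : Literature.Probability.LatticeModels.MedialVertex, z ∈ (Literature.Probability.LatticeModels.zdGraph 2).edgeSet → z' ∈ (Literature.Probability.LatticeModels.zdGraph 2).edgeSet → Literature.Probability.LatticeModels.medialPoint δ z ∈ K → Literature.Probability.LatticeModels.medialPoint δ z' ∈ K → dist (Literature.Probability.LatticeModels.medialPoint δ z) (Literature.Probability.LatticeModels.medialPoint δ z') < η → ‖F δ z - F δ z'‖ ≤ ε * δ ^ ((1:ℝ) / 3))) → (∀ (D : Literature.Probability.RandomPlanarGeometry.DobrushinDomain) (Λ : ℝ → Literature.Probability.LatticeModels.DiscreteDobrushin), (∀ δ, (Λ δ).Ω = D.carrier) → (∀ δ, (Λ δ).δ = δ) → Tendsto (fun δ : ℝ => Metric.hausdorffEDist (Λ δ).arcA (D.arc 0)) (𝓝[>] (0:ℝ)) (𝓝 0) → Tendsto (fun δ : ℝ => Metric.hausdorffEDist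 (Λ δ).arcB (D.arc 1)) (𝓝[>] (0:ℝ)) (𝓝 0) → Tendsto (fun δ : ℝ => Metric.hausdorffEDist (Literature.Probability.LatticeModels.medialPoint δ '' (Λ δ).zdABEdges) {D.pt 0, D.pt 1}) (𝓝[>] (0:ℝ)) (𝓝 0) → (∀ᶠ δ in 𝓝[>] (0:ℝ), (Λ δ).IsZdAdmissible) → Literature.Probability.RandomPlanarGeometry.ConvergesInLawToSLE 6 D (Ωδ := fun _ => Literature.Probability.Percolation.BondConfig (Literature.Probability.LatticeModels.Site 2)) (fun δ ω => Literature.Probability.RandomPlanarGeometry.CurveClass.mk (if dist (Literature.Probability.LatticeModels.medialExplorationCurve (Λ δ) ω 0) (D.pt 0) ≤ dist (Literature.Probability.LatticeModels.medialExplorationCurve (Λ δ) ω 0) (D.pt 1) then (⟨Literature.Probability.LatticeModels.medialExplorationCurve (Λ δ) ω⟩ : Literature.Probability.RandomPlanarGeometry.Curve ℂ) else ⟨(Literature.Probability.LatticeModels.medialExplorationCurve (Λ δ) ω).comp ⟨unitInterval.symm, unitInterval.continuous_symm⟩⟩)) (fun _ => Literature.Probability.Percolation.bondPercolation (Literature.Probability.LatticeModels.zdGraph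 2) Literature.Probability.Percolation.half))

/-- item stmt-CriticalPhenomena-11269 · support · rank 9 · closed · proved by Summit.CriticalPhenomena.CardyFormulaZ2.Theorems.aemeasurableInterfaceIn_proof (prover) · by planner
sources: AizenmanBurchard1999, Smirnov2001, lean:Literature.Probability.Percolation.aemeasurable_bondInterface
[support] Routine measurability lemma consumed by ParafermionToSLESixFamilies (ConvergesInLawToSLE
asks `∀ᶠ δ, AEMeasurable (X δ) (P δ)`): for discrete Dobrushin data E on the bounded domain
D.carrier with positive mesh, the endpoint-oriented medial exploration curve class ω ↦ CurveClass.mk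
(orient (medialExplorationCurve E ω)) — literally the interface map of ParafermionToSLESixFamilies /
SLESixFamiliesGiveCardy at E = Λ δ — is a.e.-measurable under P_{1/2}: meshDomain D.carrier E.δ is
finite, so medialExploration E ω ranges over finitely many lists, each fibre a finite union of
cylinder events; no admissibility needed. Family-form twin of the named fact
Literature.Probability.Percolation.aemeasurable_bondInterface (canonical data; CardySusyWard's
AEMeasurableBondInterface), stated here so that provers do not reach for that unproved fact.
[difficulty: S] [sources: AizenmanBurchard1999 §2.1, Smirnov2001 §2,
lean:Literature.Probability.Percolation.aemeasurable_bondInterface] -/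
@[route_item "route-CriticalPhenomena-CardyComplexCone"]
def AEMeasurableInterfaceIn : Prop :=
  ∀ (D : Literature.Probability.RandomPlanarGeometry.DobrushinDomain) (E : Literature.Probability.LatticeModels.DiscreteDobrushin), E.Ω = D.carrier → 0 < E.δ → AEMeasurable (fun ω : Literature.Probability.Percolation.BondConfig (Literature.Probability.LatticeModels.Site 2) => Literature.Probability.RandomPlanarGeometry.CurveClass.mk (if dist (Literature.Probability.LatticeModels.medialExplorationCurve E ω 0) (D.pt 0) ≤ dist (Literature.Probability.LatticeModels.medialExplorationCurve E ω 0) (D.pt 1) then (⟨Literature.Probability.LatticeModels.medialExplorationCurve E ω⟩ : Literature.Probability.RandomPlanarGeometry.Curve ℂ) else ⟨(Literature.Probability.LatticeModels.medialExplorationCurve E ω).comp ⟨unitInterval.symm, unitInterval.continuous_symm⟩⟩)) (Literature.Probability.Percolation.bondPercolation (Literature.Probability.LatticeModels.zdGraph 2) Literature.Probability.Percolation.half)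

-- `AEMeasurableInterfaceIn` holds: proved by `Summit.CriticalPhenomena.CardyFormulaZ2.Theorems.aemeasurableInterfaceIn_proof` (its module imports this route file, so no `_holds` link can be stated here).

/-- item stmt-CriticalPhenomena-14119 · support · rank 9 · closed · proved by Summit.CriticalPhenomena.CardyFormulaZ2.Theorems.targetOfCruxes_proof @ dffdaa70ec81 (prover) · by planner
[support] GLUE to the target (route-choice repair 2026-08-16, target reachability): the two leading
cruxes give X — EdgeCoherence → EdgePrecompact → Target. Pure logic and provable now by anyone idle:
Target (rank 0) is literally the conjunction of the bodies of EdgeCoherence (rank 2) and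
EdgePrecompact (rank 3), same text elaborated in the same context, so `fun hC hP => ⟨hC, hP⟩` closes
it (planner Sketch.lean: lean check rc 0, axioms propext / Classical.choice / Quot.sound; `Target ↔
EdgeCoherence ∧ EdgePrecompact` is Iff.rfl). It carries no mathematical content and does not touch
the deciding theorem `closes : EdgeCoherence → EdgePrecompact → CoherentMorera →
ParafermionToSLESixFamilies → SLESixFamiliesGiveCardy → CardyFormulaZ2` (certified, authority
native), which consumes the two cruxes directly; with this item the target X is reached from the
cruxes inside the item graph (X ⇐ cruxes #2, #3; X → CardyFormulaZ2 via #4–#6 = Assembly). [deps: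
EdgeCoherence, EdgePrecompact, Target] [difficulty: S] -/
@[route_item "route-CriticalPhenomena-CardyComplexCone"]
def TargetOfCruxes : Prop :=
  EdgeCoherence → EdgePrecompact → Target

-- `TargetOfCruxes` holds: proved by `Summit.CriticalPhenomena.CardyFormulaZ2.Theorems.targetOfCruxes_proof` @ dffdaa70ec81 (its module imports this route file, so no `_holds` link can be stated here).

/-- item stmt-CriticalPhenomena-18397 · support · rank 9 · open · by planner
sources: CamiaNewman2007 (§§5–7), Smirnov2001, LawlerSchrammWerner2001, BollobasRiordan2006, stmt-CriticalPhenomena-9654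
[support] SLE₆ ON ALL-DIAGONAL POLYGONS GIVES THE SUB-PROBLEM — strategists' child 4 of the summit
cut (rev 6), technique-owned and closable now: (the conclusion of SharpInputsGiveDiagSLESix,
restated verbatim) → CardyFormulaZ2. PLAN (kernel-checked composition
diagSLESixGivesCardy_of_piece1, Cruxes/ParafermionToSLESixFamilies/BridgeR1.lean): PIECE 1 = crux #6
SLESixFamiliesGiveCardy's collar-touch sandwich (cardy_of_statements with stubs A–G, all landed in
Theorems/CardyComplexConeSLESixFamiliesGiveCardy.lean) re-run at ALL-DIAGONAL designer Dobrushin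
domains — the one new piece is STUB E CollarDomains with diagonal-staircase collars behind the sides
(plateau marks g = ±x are allowed by IsSmoothMark; `frontier ⊆ ⋃ segments` upgrades to `=` for
Jordan curves), giving Cardy's crossing limit for every conformal rectangle whose frontier is
slope-±1 polygonal (= the hypothesis of PIECE 2); PIECE 2 =
FlipInvolutionReturnLaw.cardyFormulaZ2_of_diagCardy (PROVED, p134764: the diagonal Bollobás–Riordan
sandwich, DiagCardy ↔ CardyFormulaZ2) then gives CardyFormulaZ2. S → this item trivially (BC7
informational crux.summit-implies, as for every `… → S` bridge); it is used toward S only through -/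
@[route_item "route-CriticalPhenomena-CardyComplexCone", crux]
def DiagSLESixGivesCardy : Prop :=
  (∀ (D : Literature.Probability.RandomPlanarGeometry.DobrushinDomain) (Λ : ℝ → Literature.Probability.LatticeModels.DiscreteDobrushin), (∃ S : Finset (ℂ × ℂ), (∀ e ∈ S, (e.1 - e.2).re = (e.1 - e.2).im ∨ (e.1 - e.2).re = -(e.1 - e.2).im) ∧ frontier D.carrier = ⋃ e ∈ S, segment ℝ e.1 e.2) → (∀ δ, (Λ δ).Ω = D.carrier) → (∀ δ, (Λ δ).δ = δ) → Tendsto (fun δ : ℝ => Metric.hausdorffEDist (Λ δ).arcA (D.arc 0)) (𝓝[>] (0:ℝ)) (𝓝 0) → Tendsto (fun δ : ℝ => Metric.hausdorffEDist (Λ δ).arcB (D.arc 1)) (𝓝[>] (0:ℝ)) (𝓝 0) → Tendsto (fun δ : ℝ => Metric.hausdorffEDist (Literature.Probability.LatticeModels.medialPoint δ '' (Λ δ).zdABEdges) {D.pt 0, D.pt 1}) (𝓝[>] (0:ℝ)) (𝓝 0) → (∀ᶠ δ in 𝓝[>] (0:ℝ), (Λ δ).IsZdAdmissible) → Literature.Probability.RandomPlanarGeometry.ConvergesInLawToSLE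 6 D (Ωδ := fun _ => Literature.Probability.Percolation.BondConfig (Literature.Probability.LatticeModels.Site 2)) (fun δ ω => Literature.Probability.RandomPlanarGeometry.CurveClass.mk (if dist (Literature.Probability.LatticeModels.medialExplorationCurve (Λ δ) ω 0) (D.pt 0) ≤ dist (Literature.Probability.LatticeModels.medialExplorationCurve (Λ δ) ω 0) (D.pt 1) then (⟨Literature.Probability.LatticeModels.medialExplorationCurve (Λ δ) ω⟩ : Literature.Probability.RandomPlanarGeometry.Curve ℂ) else ⟨(Literature.Probability.LatticeModels.medialExplorationCurve (Λ δ) ω).comp ⟨unitInterval.symm, unitInterval.continuous_symm⟩⟩)) (fun _ => Literature.Probability.Percolation.bondPercolation (Literature.Probability.LatticeModels.zdGraph 2) Literature.Probability.Percolation.half)) → _root_.CardyFormulaZ2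

/-- item stmt-CriticalPhenomena-8789 · support · rank 9 · closed · proved by Summit.CriticalPhenomena.CardyFormulaZ2.Theorems.complexConeContraction_proof (prover) · by planner
sources: Dubois2009, Rugh2010, Birkhoff1957, HafoutaKifer2017
[support] THE ENGINE (Dubois2009 Thm 2.3 + Thm 3.6 + Lemmas 3.1–3.2, rectangular and sequential
reading; provable now from the paper, Mathlib has neither Hilbert's metric nor Birkhoff's theorem):
for θ ∈ (0,1), σ ≥ 1 there are C ≥ 0 and r ∈ [0,1) such that for every sequence of complex matrices
A_j : ℂ^{n_j} → ℂ^{n_{j+1}} (all n_j ≥ 1) satisfying, for all rows k,l and columns p,q, θ⁻¹|a_kp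
a_lq − a_kq a_lp| < Re(ā_kp a_lq + ā_kq a_lp) and |a_kp a_lq| ≤ σ²|a_kq a_lp|, every two
trajectories x_{j+1} = A_j x_j, y_{j+1} = A_j y_j started in Rugh's cone ℂ₊^{n_0}∖{0} (Re(x_k x̄_l)
≥ 0) satisfy, for m ≥ 1 and all test vectors f, g ∈ ℂ₊^{n_m}∖{0}, |⟨f,x_m⟩⟨g,y_m⟩/(⟨f,y_m⟩⟨g,x_m⟩) −
1| ≤ C·r^m (one may take r = tanh(Δ/4), Δ = 8 log((1+θ)/(1−θ)) + 2 log σ, C = 3Δe^Δ/r: δ(x_m,y_m) ≤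
Δ r^{m−1} by Thm 2.3/3.6, and all ratios ⟨f,y⟩/⟨f,x⟩ lie in E(x,y) = ∪ closed discs D_kl each
meeting y_k/x_k, inside the annulus [a,b], log(b/a) = δ). [difficulty: L] -/
@[route_item "route-CriticalPhenomena-CardyComplexCone"]
def ComplexConeContraction : Prop :=
  ∀ θ σ : ℝ, 0 < θ → θ < 1 → 1 ≤ σ → ∃ C r : ℝ, 0 ≤ C ∧ 0 ≤ r ∧ r < 1 ∧ ∀ (n : ℕ → ℕ) (A : (j : ℕ) → Matrix (Fin (n (j + 1))) (Fin (n j)) ℂ), (∀ j, 0 < n j) → (∀ j k l p q, θ⁻¹ * ‖A j k p * A j l q - A j k q * A j l p‖ < (star (A j k p) * A j l q + star (A j k q) * A j l p).re ∧ ‖A j k p * A j l q‖ ≤ σ ^ 2 * ‖A j k q * A j l p‖) → ∀ (x y : (j : ℕ) → Fin (n j) → ℂ), (∀ j, x (j + 1) = (A j).mulVec (x j)) → (∀ j, y (j + 1) = (A j).mulVec (y j)) → x 0 ≠ 0 → y 0 ≠ 0 → (∀ k l, 0 ≤ (x 0 k * star (x 0 l)).re) → (∀ k l, 0 ≤ (y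 0 k * star (y 0 l)).re) → ∀ m : ℕ, 1 ≤ m → ∀ f g : Fin (n m) → ℂ, f ≠ 0 → g ≠ 0 → (∀ k l, 0 ≤ (f k * star (f l)).re) → (∀ k l, 0 ≤ (g k * star (g l)).re) → ‖(∑ k, f k * x m k) * (∑ k, g k * y m k) / ((∑ k, f k * y m k) * (∑ k, g k * x m k)) - 1‖ ≤ C * r ^ m

-- `ComplexConeContraction` holds: proved by `Summit.CriticalPhenomena.CardyFormulaZ2.Theorems.complexConeContraction_proof` (its module imports this route file, so no `_holds` link can be stated here).

/-- item stmt-CriticalPhenomena-9644 · support · rank 9 · closed · proved by Summit.CriticalPhenomena.CardyFormulaZ2.Theorems.DiscretisationFamilyExists_proof @ 387f8440f586 (prover) · by planner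
[support] CONSTRUCTION statement for the interface the cruxes are stated over: every Dobrushin
domain D admits a family Λ : ℝ → DiscreteDobrushin with (Λ δ).Ω = D.carrier, (Λ δ).δ = δ, arcs →
(ab), (ba) and discrete marked points (midpoints of the A–B edges) → {a, b} in Hausdorff distance,
and ℤ²-admissible data for all small δ > 0 (i.e. IsDiscretisation D Λ, unbundled). Expected witness:
arcs rotated by a mesh-dependent angle ≍ δ so that no boundary site is equidistant from the two arcs
(InterfaceScalingLimitDiscretised.lean, docstring §2 — not formalised for any domain yet). Certifies
that the family-form items are not vacuous; consumed by SLESixFamiliesGiveCardy. Risk: a Jordan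
boundary so rough near a mark that every choice leaves an A–B edge without an inner face at
infinitely many meshes. [difficulty: L] [sources: CDHKS2014, Smirnov2001, ChelkakSmirnov2012,
lean:Literature.Probability.Percolation.not_isZdAdmissible_dobrushinData_unitDisc] -/
@[route_item "route-CriticalPhenomena-CardyComplexCone"]
def DiscretisationFamilyExists : Prop :=
  ∀ (D : Literature.Probability.RandomPlanarGeometry.DobrushinDomain), ∃ Λ : ℝ → Literature.Probability.LatticeModels.DiscreteDobrushin, (∀ δ, (Λ δ).Ω = D.carrier) ∧ (∀ δ, (Λ δ).δ = δ) ∧ Filter.Tendsto (fun δ : ℝ => Metric.hausdorffEDist (Λ δ).arcA (D.arc 0)) (nhdsWithin (0:ℝ) (Set.Ioi 0)) (nhds 0) ∧ Filter.Tendsto (fun δ : ℝ => Metric.hausdorffEDist (Λ δ).arcB (D.arc 1)) (nhdsWithin (0:ℝ) (Set.Ioi 0)) (nhds 0) ∧ Filter.Tendsto (fun δ : ℝ => Metric.hausdorffEDist (Literature.Probability.LatticeModels.medialPoint δ '' (Λ δ).zdABEdges) {D.pt 0, D.pt 1}) (nhdsWithin (0:ℝ) (Set.Ioi 0)) (nhds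 0) ∧ (∀ᶠ δ in nhdsWithin (0:ℝ) (Set.Ioi 0), (Λ δ).IsZdAdmissible)

/-- `DiscretisationFamilyExists` holds: proved by `Summit.CriticalPhenomena.CardyFormulaZ2.Theorems.DiscretisationFamilyExists_proof` @ 387f8440f586. -/
theorem DiscretisationFamilyExists_holds : DiscretisationFamilyExists := _root_.Summit.CriticalPhenomena.CardyFormulaZ2.Theorems.DiscretisationFamilyExists_proof

-- earlier Assembly (stmt-CriticalPhenomena-8790, replaced 2026-08-15T16:55:12Z -> stmt-CriticalPhenomena-11267): retired by None — EdgeCoherence → EdgePrecompact → CoherentMorera → ParafermionToSLESix → SLESixGivesCardy → CardyFormulaZ2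
/-- item stmt-CriticalPhenomena-11267 · assembly · rank 1 · closed · proved by Summit.CriticalPhenomena.CardyFormulaZ2.Theorems.cardyComplexCone_assembly_proof @ 7344b488c6d3 (prover) · by planner
sources: DuminilCopinSmirnov2012Lattice, Smirnov2001, Dubois2009
[assembly] EdgeCoherence → EdgePrecompact → CoherentMorera → ParafermionToSLESixFamilies →
SLESixFamiliesGiveCardy → CardyFormulaZ2 (rev 2, family form; the deciding theorem `closes` has
exactly this type and is pure modus ponens). -/
@[route_item "route-CriticalPhenomena-CardyComplexCone"]
def Assembly : Prop :=
  EdgeCoherence → EdgePrecompact → CoherentMorera → ParafermionToSLESixFamilies → SLESixFamiliesGiveCardy → CardyFormulaZ2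

-- `Assembly` holds: proved by `Summit.CriticalPhenomena.CardyFormulaZ2.Theorems.cardyComplexCone_assembly_proof` @ 7344b488c6d3 (its module imports this route file, so no `_holds` link can be stated here).

/-! D-0027 §2.1 — DECIDING THEOREM (planner-authored via `route open/edit --closes-file`; by planner-rbadge-CriticalPhenomena-CardyComplexC-acd27aeb-g3-0 2026-08-17T16:00:03Z):
its hypotheses are this route's items and its conclusion the sub-problem Statement (glue_lint), and it elaborates with this file. -/

@[closes "route-CriticalPhenomena-CardyComplexCone"] theorem closes (hC : EdgeCoherence) (hP : EdgePrecompact) (hU : UniformInnerEnvelope) (hN : DiagBoundaryArmLower)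
    (h3 : SharpInputsGiveDiagSLESix) (h4 : DiagSLESixGivesCardy) : _root_.CardyFormulaZ2 :=
  h4 (h3 hN hU hC hP)

end Summit.CriticalPhenomena.CardyFormulaZ2.Theses.CardyComplexCone
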